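import Literature.NumberTheory.NumberFields.CMFieldCapitulationKernel
import Literature.NumberTheory.NumberFields.HasseUnitIndexOddDegree
import Mathlib.RingTheory.Norm.Transitivity
import Mathlib.FieldTheory.PrimitiveElement
import Mathlib.FieldTheory.IsAlgClosed.AlgebraicClosure
import HarnessLib

/-!
# The capitulation kernel `κ_F = #ker(C_{F⁺} → C_F)` in inclusions of CM fields: `κ_k Q_k w_k ∣ κ_K Q_K w_K`,
# `κ_k = κ_K` in odd degree, and `κ_F Q_F = 2 ⟺ F` non-primary (Okazaki, *Acta Arith.* 92 (2000), §3 Lemmas 14, 16)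

Topic `NumberTheory/NumberFields`; namespace `Literature.NumberTheory.NumberFields`.  Theorem-only file
(no definition, no named fact, no `sorry`), unconditional.  Sequel of `CMFieldCapitulationKernel.lean`
(Washington Thm. 10.3: `κ_F ≤ 2`, `ᾱ = α u` with `u` a root of unity, `Q_F = 2 ⇒ κ_F = 1`) and of
`HasseUnitIndexOddDegree.lean` (the discharged fact `Lemmermeyer1995_unitIndex_eq_of_odd_degree`:
`Q_k = Q_K` for `[K : k]` odd — the unit-index half of Okazaki's Lemma 16).

> Okazaki, §3: "The order of the kernel of the homomorphism `C_{F⁺} → C_F` induced by `ι_F` is denoted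
> by `κ_F`", "`Q_F = [E_F : W_F E_{F⁺}]`".  **Lemma 16.** "Let `k ⊂ K` be two CM-fields.  Then
> `κ_k Q_k w_k ∣ κ_K Q_K w_K` and `Q_k w_k ∣ Q_K w_K`.  In particular, `κ_k = κ_K` and `Q_k = Q_K` if
> `[K : k]` is odd.  *Proof.* This follows from a characterization of `κ_F` and `Q_F` of a CM-field `F`
> that is used in the proofs for [27, Theorems 4.12 and 10.3] (cf. [10] for subtle examples)."
> ([27] = Washington, *Introduction to Cyclotomic Fields*.)

We write `(K, L)` for Okazaki's `(k, K)` and prove the «in particular» clause: **for CM fields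
`K ⊆ L` with `[L : K]` odd, `κ_K = κ_L`** (and, from the tree, `Q_K = Q_L`).  The characterization
used (Washington Thm. 10.3, proof): for an ideal `𝔞` of `𝓞_{F⁺}` with `𝔞𝓞_F = (α)` one has `ᾱ = αu`
with `u ∈ W_F`, and `𝔞` is principal iff `u ∈ φ(E_F)`, `φ(ε) = ε/ε̄` (§3); moreover `𝔞𝓞_F = (α)` iff
`𝔞² = (αᾱ)` in `𝓞_{F⁺}` (unique square roots of ideals).  Then:

1. (§1) a root of unity of `K` which becomes a square of a root of unity in `L` is already a square in
   `W_K` (apply `N_{L/K}`: `u^{[L:K]} = N(ζ)²`, `[L : K]` odd);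
2. (§2) **`N_{L/K}(y) = N_{L⁺/K⁺}(y)` for `y ∈ L⁺`** (restriction is a bijection from the `K`-embeddings
   of `L` to the `K⁺`-embeddings of `L⁺`: `[L : K] = [L⁺ : K⁺]` and `L = L⁺ + jL⁺` for a purely
   imaginary `j ∈ K`);
3. (§4) `κ_K = 2 ⇒ κ_L = 2`: a non-trivial capitulating class `c` of `K⁺` extends to `L⁺`, still
   capitulating (Neukirch (1.6)(i)) and still non-trivial (`N_{L⁺/K⁺} ι c = c^{[L:K]} = c`, as `c² = 1`);
   `κ_L = 2 ⇒ κ_K = 2`: `κ_L = 2` forces `Q_L = 1`, hence `Q_K = 1`; take a non-principal `𝔅 ⊆ 𝓞_{L⁺}`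
   with `𝔅𝓞_L = (α)` and, adjusting `α` by a unit (`[W_L : φ(E_L)] = 2`), `ᾱ = α u₀` for a NON-SQUARE
   root of unity `u₀` OF `K`; then `𝔞 = N_{L⁺/K⁺}(𝔅)` has `𝔞² = (N_{L⁺/K⁺}(αᾱ))`,
   `N_{L⁺/K⁺}(αᾱ) = N_{L/K}(αᾱ) = ββ̄` with `β = N_{L/K}(α)·u₀^m` (`[L:K] = 2m+1`), `β̄ = βu₀`, so
   `𝔞𝓞_K = (β)` and `𝔞` is not principal (`u₀ ∉ φ(E_K)` as `Q_K = 1`): `κ_K = 2`.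
4. (§5, §6) the two GENERAL divisibilities of Lemma 16, for every pair of CM fields: `Q_K w_K ∣ Q_L w_L`
   (`φ(E_K) ↪ φ(E_L)`, `Q w = 2 #φ(E)`) and **`κ_K Q_K w_K ∣ κ_L Q_L w_L`** — the characterization made
   into a count: the roots of unity `ᾱ/α` of the generators of extended ideals `𝔞𝓞_F = (α)` form a
   subgroup `U_F ≤ W_F` with `φ(E_F) ≤ U_F` and `U_F/φ(E_F) ≃ ker(C_{F⁺} → C_F)` (`ᾱ/α ↦ [𝔞]` is well
   defined: two generators with the same root of unity give `𝔞𝔟` principal), so `2 #U_F = κ_F Q_F w_F`,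
   and `U_K ↪ U_L` along `W_K ↪ W_L`.
5. (§7) Lemma 14's characterizations: `κ_F Q_F = 2 ⟺ −1 ∈ U_F ⟺ F = F⁺(√−δ)` with `(δ)` a square ideal
   («non-primary»), `Q_F = 2 ⟺ −1 ∈ φ(E_F) ⟺ F = F⁺(√−η)` with `η` a unit («unit radical form»), the
   converses holding unless `√−1 ∈ F` (when `κ_F Q_F = 1`, resp. `Q_F = 1`, the subgroup is `W_F²`).

## Main results (`K L : Type` CM number fields, `L` a `K`-algebra; `K⁺ = maximalRealSubfield K`,
`ι_K = classGroupExtend K⁺ K`, `φ = unitsMulComplexConjInv`, `W = torsion`)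

* `exists_torsion_sq_eq_of_odd` — `[L:K]` odd, `u ∈ E_K` a square in `W_L` ⟹ `u` a square in `W_K`.
* **`IsCMField.algebraMap_norm_eq_norm`** — `N_{L⁺/K⁺}(y) = N_{L/K}(y)` for `y ∈ L⁺` (any algebra
  `K⁺ → L⁺` compatible with `K → L`).
* `IsCMField.isPrincipal_of_mem_range`, `IsCMField.mem_range_of_isPrincipal` — for `𝔞𝓞_K = (α)`,
  `ᾱ = αu`: `𝔞` principal ⟺ `u ∈ φ(E_K)` (Washington 10.3's injection `ker ι_K ↪ W_K/φ(E_K)`).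
* `IsCMField.sq_eq_span_of_map_eq_span`, `IsCMField.map_eq_span_of_sq_eq_span` — `𝔞𝓞_K = (α)` ⟺
  `𝔞² = (αᾱ)` (given `ᾱ = αu`).
* `IsCMField.ker_classGroupExtend_ne_bot_of_odd`, `…_of_odd'` — the two transfers for `[L:K]` odd.
* **`IsCMField.card_ker_classGroupExtend_eq_of_odd`** — **Lemma 16: `[L : K]` odd ⟹ `κ_K = κ_L`**;
  `IsCMField.card_ker_classGroupExtend_eq_and_indexRealUnits_eq_of_odd` — with `Q_K = Q_L` (tree).
* `IsCMField.indexRealUnits_mul_torsionOrder_dvd` — Lemma 16's `Q_K w_K ∣ Q_L w_L` (every CM pair, §5).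
* `IsCMField.mk0_eq_mk0_of_conj_eq_mul` — `𝔞𝓞_K = (α)`, `𝔟𝓞_K = (β)`, `ᾱ/α = β̄/β` ⟹ `[𝔞] = [𝔟]` (§6).
* `IsCMField.exists_subgroup_torsion_two_mul_card_eq` — Washington's subgroup `U_K ≤ W_K` of the `ᾱ/α`,
  with `φ(E_K) ≤ U_K` and **`2 #U_K = κ_K Q_K w_K`** (`IsCMField.card_eq_card_ker_mul_card_range_of_mem_iff`:
  `#U_K = κ_K #φ(E_K)`); `IsCMField.card_ker_classGroupExtend_dvd_index_range` — `κ_K ∣ [W_K : φ(E_K)]`.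
* **`IsCMField.card_ker_classGroupExtend_mul_indexRealUnits_mul_torsionOrder_dvd`** — **Lemma 16's
  `κ_K Q_K w_K ∣ κ_L Q_L w_L`** for every pair of CM fields (§6); `IsCMField.okazaki_lemma16_dvd` — both
  divisibilities as printed.
* `IsCMField.adjoin_simple_eq_top_of_complexConj_ne` — `ᾱ ≠ α ⟹ F⁺(α) = F`;
  `IsCMField.embedding_pos_of_algebraMap_eq_mul_conj` — `x x̄` is totally positive (§7).
* **`IsCMField.exists_sq_eq_neg_of_card_ker_mul_indexRealUnits_eq_two`** (Lemma 14: `κ_F Q_F = 2 ⟹ F`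
  non-primary), **`IsCMField.card_ker_mul_indexRealUnits_eq_two_of_sq_eq_neg`** (converse unless `√−1 ∈ F`),
  **`IsCMField.exists_unit_sq_eq_neg_of_indexRealUnits_eq_two`** (`Q_F = 2 ⟹` unit radical form),
  **`IsCMField.indexRealUnits_eq_two_of_unit_conj_eq_neg`** (converse unless `√−1 ∈ F`),
  `IsCMField.lemma14_iff` (§7).

Honest column: Okazaki prints no proof of Lemmas 14 and 16 (he cites [16] and the proofs of Washington's
Thms. 4.12 and 10.3, and Hirabayashi–Yoshino); the route is ours along that characterization.  Of Lemma 14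
the ramification clauses («`F` is non-primary if `F/F⁺` is unramified at the finite primes»; «`F/F⁺` is
unramified at all odd primes if `F` is non-primary») are NOT formalised; «`F = F⁺(√−δ)`» is rendered by an
integral `α ≠ 0` with `ᾱ = −α`, `α² = −δ` (`δ ∈ 𝓞_{F⁺}`; a general `δ ∈ F⁺` is reduced to this by a square
factor), and «unless `F = F⁺(√−1)`» by the hypothesis that `−1` is not a square in `F`.  The subgroup `U_F` of §6
is not introduced as a definition: it enters statements through its membership predicate
(`∃ 𝔞 α, α ≠ 0 ∧ 𝔞𝓞_F = (α) ∧ ᾱ = αu`) and an existential over `Subgroup (torsion F)`.  The algebra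
`K⁺ → L⁺` (restriction of `K → L`) is built locally inside the proofs and appears in §2's statement only
as an arbitrary compatible instance.

## References

* R. Okazaki, *Inclusion of CM-fields and divisibility of relative class numbers*, Acta Arith. 92 (2000)
  319–338, §3 (Def. 13, Lemmas 14, 16) (held `paper:doi-10-4064-aa-92-4-319-338`, pp. 8–9). [Okazaki2000]
* L. C. Washington, *Introduction to Cyclotomic Fields*, 2nd ed., GTM 83 (1997), Thms. 4.12, 10.3.
  [Washington1997]
* F. Lemmermeyer, *Ideal class groups of cyclotomic number fields I*, Acta Arith. 72 (1995), §2 Prop. 1 f)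
  (after Hirabayashi–Yoshino). [Lemmermeyer1995]
* J. Neukirch, *Algebraic Number Theory*, Grundlehren 322 (1999), Ch. III §1 Prop. (1.6). [NeukirchANT1999]
-/

noncomputable section

open NumberField NumberField.IsCMField NumberField.Units IsDedekindDomain
open scoped nonZeroDivisors

namespace Literature.NumberTheory.NumberFields

/-! ### §1. Torsion units: a non-square root of unity of `K` stays a non-square in `L`, `[L:K]` odd -/

section Torsion

variable (K L : Type) [Field K] [NumberField K] [Field L] [NumberField L] [Algebra K L]

omit [NumberField K] [NumberField L] in
/-- If `[L : K]` is odd and the unit `u` of `K` becomes the square of a root of unity in `L`, then `u`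
is the square of a root of unity of `K` (apply `N_{L/K}`: `u^{[L:K]} = N(ζ)²`).
[cite: Okazaki2000, §3 Lemma 16 (proof, «a characterization of κ_F and Q_F»)] -/
theorem exists_torsion_sq_eq_of_odd (hodd : Odd (Module.finrank K L)) (u : (𝓞 K)ˣ)
    (h : ∃ ζ ∈ torsion L, Units.map (algebraMap (𝓞 K) (𝓞 L) : 𝓞 K →* 𝓞 L) u = ζ ^ 2) :
    ∃ ξ ∈ torsion K, u = ξ ^ 2 := by
  obtain ⟨ζ, hζ, hu⟩ := h
  obtain ⟨m, hm⟩ := hodd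
  set N : (𝓞 L)ˣ →* (𝓞 K)ˣ := Units.map (RingOfIntegers.norm K) with hN
  have hNu : N (Units.map (algebraMap (𝓞 K) (𝓞 L) : 𝓞 K →* 𝓞 L) u) = u ^ Module.finrank K L :=
    Lemmermeyer1995.unitsNorm_unitsMap K L u
  have hNζ : N ζ ∈ torsion K := by
    rw [torsion, CommGroup.mem_torsion] at hζ ⊢
    exact N.isOfFinOrder hζ
  refine ⟨N ζ * (u ^ m)⁻¹, mul_mem hNζ (inv_mem (pow_mem ?_ m)), ?_⟩
  · -- `u` itself is torsion: `u ^ [L:K] = N ζ ^ 2` is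
    rw [torsion, CommGroup.mem_torsion]
    have hfin : IsOfFinOrder (u ^ Module.finrank K L) := by
      rw [← hNu, hu, map_pow]
      exact ((CommGroup.mem_torsion _).mp hNζ).pow
    exact hfin.of_pow (by omega)
  · have key : u ^ Module.finrank K L = N ζ ^ 2 := by rw [← hNu, hu, map_pow]
    rw [hm] at key
    rw [mul_pow, inv_pow, ← pow_mul, ← key, mul_comm m 2, pow_succ, mul_comm (u ^ (2 * m)) u,
      mul_assoc, mul_inv_cancel, mul_one]

end Torsion

/-! ### §2. Norms of real elements: `N_{L/K}(y) = N_{L⁺/K⁺}(y)` for `y ∈ L⁺` -/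

section NormBaseChange

variable (K L : Type) [Field K] [NumberField K] [IsCMField K] [Field L] [NumberField L] [IsCMField L]
  [Algebra K L]

/-- A CM field has a nonzero purely imaginary element `j` (`j̄ = -j`). [folklore] -/
private theorem exists_conj_eq_neg : ∃ j : K, j ≠ 0 ∧ complexConj K j = -j := by
  have h : ∃ x : K, complexConj K x ≠ x := by
    by_contra hx
    exact complexConj_ne_one K (AlgEquiv.ext fun x => not_not.mp (not_exists.mp hx x))
  obtain ⟨x, hx⟩ := h
  refine ⟨x - complexConj K x, sub_ne_zero.mpr (Ne.symm hx), ?_⟩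
  rw [map_sub, complexConj_apply_apply, neg_sub]

/-- Every `z ∈ L` is `(a + j b)/2` with `a, b ∈ L⁺`, for a purely imaginary `j ∈ K`: two `K`-algebra
maps out of `L` that agree on `L⁺` are equal. [folklore] -/
private theorem algHom_ext_of_eq_on_maximalRealSubfield {E : Type*} [Field E] [Algebra K E]
    (σ₁ σ₂ : L →ₐ[K] E)
    (h : ∀ y : maximalRealSubfield L, σ₁ (algebraMap (maximalRealSubfield L) L y) =
      σ₂ (algebraMap (maximalRealSubfield L) L y)) : σ₁ = σ₂ := by
  obtain ⟨j, hj0, hj⟩ := exists_conj_eq_neg K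
  have hjL : complexConj L (algebraMap K L j) = -algebraMap K L j := by
    rw [Lemmermeyer1995.complexConj_algebraMap K L, hj, map_neg]
  have hjL0 : algebraMap K L j ≠ 0 := (map_ne_zero _).mpr hj0
  ext z
  -- `a = z + z̄`, `b = (z - z̄)/j` lie in `L⁺`
  have ha : z + complexConj L z ∈ maximalRealSubfield L := by
    rw [← complexConj_eq_self_iff, map_add, complexConj_apply_apply, add_comm]
  have hb : (z - complexConj L z) * (algebraMap K L j)⁻¹ ∈ maximalRealSubfield L := by
    rw [← complexConj_eq_self_iff, map_mul, map_sub, complexConj_apply_apply, map_inv₀, hjL, inv_neg,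
      mul_neg, ← neg_mul, neg_sub]
  have hz : z = (2 : K)⁻¹ • (algebraMap (maximalRealSubfield L) L ⟨_, ha⟩ +
      j • algebraMap (maximalRealSubfield L) L ⟨_, hb⟩) := by
    change z = (2 : K)⁻¹ • ((z + complexConj L z) + j • ((z - complexConj L z) * (algebraMap K L j)⁻¹))
    rw [Algebra.smul_def j, ← mul_assoc, mul_comm (algebraMap K L j), mul_assoc, mul_inv_cancel₀ hjL0,
      mul_one, Algebra.smul_def, map_inv₀, map_ofNat]
    field_simp
    ring
  rw [hz, map_smul, map_smul, map_add, map_add, map_smul, map_smul, h, h]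

/-- **`N_{L/K}(y) = N_{L⁺/K⁺}(y)` for `y ∈ L⁺`**, CM fields `K ⊆ L` (for any algebra `K⁺ → L⁺` compatible
with `K → L`): the restriction `σ ↦ σ|_{L⁺}` is a bijection from the `K`-embeddings of `L` to the
`K⁺`-embeddings of `L⁺` into an algebraically closed field (`[L : K] = [L⁺ : K⁺]`, and `L = L⁺ + jL⁺`).
[cite: Okazaki2000, §3 Lemma 16 (proof)] [cite: Washington1997, Thm. 10.3 (proof)] -/
theorem IsCMField.algebraMap_norm_eq_norm [Algebra (maximalRealSubfield K) (maximalRealSubfield L)]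
    [IsScalarTower (maximalRealSubfield K) (maximalRealSubfield L) L] (y : maximalRealSubfield L) :
    algebraMap (maximalRealSubfield K) K (Algebra.norm (maximalRealSubfield K) y) =
      Algebra.norm K (algebraMap (maximalRealSubfield L) L y) := by
  classical
  set E := AlgebraicClosure L
  apply (algebraMap K E).injective
  -- degrees: `[L : K] = [L⁺ : K⁺]`
  have hdeg : Module.finrank K L = Module.finrank (maximalRealSubfield K) (maximalRealSubfield L) := by
    have h1 := Module.finrank_mul_finrank (maximalRealSubfield K) K L
    have h2 := Module.finrank_mul_finrank (maximalRealSubfield K) (maximalRealSubfield L) L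
    rw [Algebra.IsQuadraticExtension.finrank_eq_two (maximalRealSubfield K) K] at h1
    rw [Algebra.IsQuadraticExtension.finrank_eq_two (maximalRealSubfield L) L] at h2
    omega
  -- the restriction map on embeddings
  let r : (L →ₐ[K] E) → (maximalRealSubfield L →ₐ[maximalRealSubfield K] E) := fun σ =>
    (σ.restrictScalars (maximalRealSubfield K)).comp
      (IsScalarTower.toAlgHom (maximalRealSubfield K) (maximalRealSubfield L) L)
  have hr : Function.Bijective r := by
    rw [Fintype.bijective_iff_injective_and_card, AlgHom.card, AlgHom.card, hdeg]
    refine ⟨fun σ₁ σ₂ hσ => algHom_ext_of_eq_on_maximalRealSubfield K L σ₁ σ₂ fun y => ?_, rfl⟩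
    exact congrArg (fun τ : maximalRealSubfield L →ₐ[maximalRealSubfield K] E => τ y) hσ
  rw [← IsScalarTower.algebraMap_apply, Algebra.norm_eq_prod_embeddings, Algebra.norm_eq_prod_embeddings,
    ← Fintype.prod_equiv (Equiv.ofBijective r hr) (fun σ => σ (algebraMap (maximalRealSubfield L) L y))
      (fun τ => τ y) (fun σ => rfl)]

end NormBaseChange

/-! ### §3. Capitulation in `F/F⁺`: principal generators, the root of unity `ᾱ/α`, and squares in `F⁺` -/

section Single

variable (K : Type) [Field K] [NumberField K] [IsCMField K]

omit [IsCMField K] in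
/-- Extension of ideals `𝓞 K⁺ → 𝓞 K` is injective. [folklore] -/
private theorem ideal_map_injective' :
    Function.Injective
      (Ideal.map (algebraMap (𝓞 (maximalRealSubfield K)) (𝓞 K)) :
        Ideal (𝓞 (maximalRealSubfield K)) → Ideal (𝓞 K)) := by
  intro I J h
  have hinj := FractionalIdeal.extendedHom_injective (𝓞 (maximalRealSubfield K)) (maximalRealSubfield K)
    (L := K) (B := 𝓞 K)
  have h' : FractionalIdeal.extendedHom K (𝓞 K)
      ((I : FractionalIdeal (𝓞 (maximalRealSubfield K))⁰ (maximalRealSubfield K))) =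
      FractionalIdeal.extendedHom K (𝓞 K)
      ((J : FractionalIdeal (𝓞 (maximalRealSubfield K))⁰ (maximalRealSubfield K))) := by
    rw [FractionalIdeal.extendedHom_coeIdeal_eq_map, FractionalIdeal.extendedHom_coeIdeal_eq_map, h]
  exact FractionalIdeal.coeIdeal_injective (hinj h')

/-- In a Dedekind domain, `I² = J² ⟹ I = J` for ideals. [folklore] -/
private theorem ideal_eq_of_sq_eq {R : Type*} [CommRing R] [IsDedekindDomain R] {I J : Ideal R}
    (h : I ^ 2 = J ^ 2) : I = J := by
  classical
  by_cases hI : I = ⊥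
  · subst hI
    rw [Ideal.zero_eq_bot.symm, zero_pow two_ne_zero, eq_comm, pow_eq_zero_iff two_ne_zero] at h
    exact h.symm
  by_cases hJ : J = ⊥
  · subst hJ
    rw [Ideal.zero_eq_bot.symm, zero_pow two_ne_zero, pow_eq_zero_iff two_ne_zero] at h
    exact h
  have key : UniqueFactorizationMonoid.normalizedFactors I =
      UniqueFactorizationMonoid.normalizedFactors J := by
    have h2 := congrArg UniqueFactorizationMonoid.normalizedFactors h
    rw [UniqueFactorizationMonoid.normalizedFactors_pow, UniqueFactorizationMonoid.normalizedFactors_pow]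
      at h2
    ext p
    have h3 := congrArg (Multiset.count p) h2
    simp only [Multiset.count_nsmul] at h3
    omega
  exact associated_iff_eq.mp
    ((UniqueFactorizationMonoid.associated_iff_normalizedFactors_eq_normalizedFactors hI hJ).mpr key)

omit [IsCMField K] in
/-- A capitulating class of `K⁺` is represented by `𝔞 ≠ 0` with `𝔞𝓞_K = (α)`, `α ≠ 0`. [folklore] -/
private theorem exists_rep_of_mem_ker {c : ClassGroup (𝓞 (maximalRealSubfield K))}
    (hc : classGroupExtend (maximalRealSubfield K) K c = 1) :
    ∃ (𝔞 : Ideal (𝓞 (maximalRealSubfield K))) (h𝔞 : 𝔞 ≠ ⊥) (α : 𝓞 K),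
      c = ClassGroup.mk0 ⟨𝔞, mem_nonZeroDivisors_of_ne_zero h𝔞⟩ ∧
      𝔞.map (algebraMap (𝓞 (maximalRealSubfield K)) (𝓞 K)) = Ideal.span {α} ∧ α ≠ 0 := by
  obtain ⟨⟨𝔞, h𝔞⟩, rfl⟩ := ClassGroup.mk0_surjective c
  have h𝔞0 : 𝔞 ≠ ⊥ := nonZeroDivisors.ne_zero h𝔞
  rw [classGroupExtend_mk0, ClassGroup.mk0_eq_one_iff] at hc
  obtain ⟨α, hα⟩ := hc
  have hα' : 𝔞.map (algebraMap (𝓞 (maximalRealSubfield K)) (𝓞 K)) = Ideal.span {α} := hα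
  refine ⟨𝔞, h𝔞0, α, rfl, hα', ?_⟩
  rintro rfl
  rw [Ideal.span_singleton_eq_bot.mpr rfl,
    Ideal.map_eq_bot_iff_of_injective (FaithfulSMul.algebraMap_injective _ _)] at hα'
  exact h𝔞0 hα'

/-- The complex conjugate of a unit, as an element of `𝓞 K`. [folklore] -/
private theorem coe_unitsComplexConj' (η : (𝓞 K)ˣ) :
    ((unitsComplexConj K η : (𝓞 K)ˣ) : 𝓞 K) = ringOfIntegersComplexConj K (η : 𝓞 K) := rfl

/-- **If `𝔞𝓞_K = (α)` with `ᾱ = α u` and `u = φ(η) = η/η̄` for a unit `η`, then `𝔞` is principal**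
(`γ = α η` is conjugation-fixed and generates `𝔞𝓞_K`; Washington's injection `ker(C_{K⁺} → C_K) ↪ W/φ(E)`).
[cite: Washington1997, Thm. 10.3 (proof)] [cite: Okazaki2000, §3 Lemma 14 (proof reference)] -/
theorem IsCMField.isPrincipal_of_mem_range {𝔞 : Ideal (𝓞 (maximalRealSubfield K))} {α : 𝓞 K}
    (hα : 𝔞.map (algebraMap (𝓞 (maximalRealSubfield K)) (𝓞 K)) = Ideal.span {α}) {u : (𝓞 K)ˣ}
    (hut : u ∈ torsion K) (hu : ringOfIntegersComplexConj K α = α * u)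
    (hmem : (⟨u, hut⟩ : torsion K) ∈ (unitsMulComplexConjInv K).range) : 𝔞.IsPrincipal := by
  obtain ⟨η, hη⟩ := hmem
  have hη' : (u : 𝓞 K) * ringOfIntegersComplexConj K (η : 𝓞 K) = (η : 𝓞 K) := by
    have h := congrArg (fun t : torsion K => ((t : (𝓞 K)ˣ) : 𝓞 K)) hη
    simp only [unitsMulComplexConjInv_apply] at h
    rw [← coe_unitsComplexConj', ← h, Units.val_mul, mul_assoc, ← Units.val_mul, inv_mul_cancel,
      Units.val_one, mul_one]
  have hfix : ringOfIntegersComplexConj K (α * (η : 𝓞 K)) = α * (η : 𝓞 K) := by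
    rw [map_mul, hu, mul_assoc, hη']
  have hspan : 𝔞.map (algebraMap (𝓞 (maximalRealSubfield K)) (𝓞 K)) = Ideal.span {α * (η : 𝓞 K)} := by
    rw [hα, Ideal.span_singleton_mul_right_unit η.isUnit]
  exact isPrincipal_of_map_eq_span_of_conj_eq K hspan hfix

/-- **Conversely, if `𝔞 = (a)` is principal, `𝔞𝓞_K = (α)` and `ᾱ = α u`, then `u ∈ φ(E_K)`**
(`α = a ε` for a unit `ε`, and `u = ε̄/ε = φ(ε⁻¹)`). [cite: Washington1997, Thm. 10.3 (proof)]
[cite: Okazaki2000, §3 Lemma 14 (proof reference)] -/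
theorem IsCMField.mem_range_of_isPrincipal {𝔞 : Ideal (𝓞 (maximalRealSubfield K))} {α : 𝓞 K}
    (hα : 𝔞.map (algebraMap (𝓞 (maximalRealSubfield K)) (𝓞 K)) = Ideal.span {α}) (hα0 : α ≠ 0)
    {u : (𝓞 K)ˣ} (hut : u ∈ torsion K) (hu : ringOfIntegersComplexConj K α = α * u)
    (hprin : 𝔞.IsPrincipal) : (⟨u, hut⟩ : torsion K) ∈ (unitsMulComplexConjInv K).range := by
  obtain ⟨a, ha⟩ := (Submodule.isPrincipal_iff _).mp hprin
  have ha' : 𝔞 = Ideal.span {a} := ha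
  rw [ha', Ideal.map_span, Set.image_singleton] at hα
  obtain ⟨ε, hε⟩ := Ideal.span_singleton_eq_span_singleton.mp hα
  -- `hε : algebraMap a * ε = α`
  have ha0 : (algebraMap (𝓞 (maximalRealSubfield K)) (𝓞 K) a) ≠ 0 := by
    rintro h0
    rw [h0, zero_mul] at hε
    exact hα0 hε.symm
  have hfix : ringOfIntegersComplexConj K (algebraMap (𝓞 (maximalRealSubfield K)) (𝓞 K) a) =
      algebraMap (𝓞 (maximalRealSubfield K)) (𝓞 K) a := (ringOfIntegersComplexConj K).commutes a
  -- `ε̄ = ε u`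
  have hεu : ringOfIntegersComplexConj K (ε : 𝓞 K) = (ε : 𝓞 K) * u := by
    have h := hu
    rw [← hε, map_mul, hfix, mul_assoc] at h
    exact mul_left_cancel₀ ha0 h
  refine ⟨ε⁻¹, Subtype.ext ?_⟩
  rw [unitsMulComplexConjInv_apply, map_inv, inv_inv]
  apply Units.ext
  rw [Units.val_mul, coe_unitsComplexConj', hεu, ← mul_assoc, Units.inv_mul, one_mul]

/-- **`𝔞𝓞_K = (α)`, `ᾱ = αu` ⟹ `𝔞² = (αᾱ)` in `𝓞 K⁺`.** [cite: Okazaki2000, §3 Def. 13 and Lemma 14 («non-primary»)] -/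
theorem IsCMField.sq_eq_span_of_map_eq_span {𝔞 : Ideal (𝓞 (maximalRealSubfield K))} {α : 𝓞 K}
    (hα : 𝔞.map (algebraMap (𝓞 (maximalRealSubfield K)) (𝓞 K)) = Ideal.span {α}) {u : (𝓞 K)ˣ}
    (hu : ringOfIntegersComplexConj K α = α * u) {d : 𝓞 (maximalRealSubfield K)}
    (hd : algebraMap (𝓞 (maximalRealSubfield K)) (𝓞 K) d = α * ringOfIntegersComplexConj K α) :
    𝔞 ^ 2 = Ideal.span {d} := by
  apply ideal_map_injective' K
  rw [Ideal.map_pow, hα, Ideal.map_span, Set.image_singleton, hd, hu, ← mul_assoc,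
    Ideal.span_singleton_pow, pow_two, Ideal.span_singleton_mul_right_unit u.isUnit]

/-- **Conversely `𝔞² = (αᾱ)`, `ᾱ = αu` ⟹ `𝔞𝓞_K = (α)`** (unique square roots of ideals).
[cite: Okazaki2000, §3 Def. 13 and Lemma 14 («non-primary»)] -/
theorem IsCMField.map_eq_span_of_sq_eq_span {𝔞 : Ideal (𝓞 (maximalRealSubfield K))} {α : 𝓞 K}
    {u : (𝓞 K)ˣ} (hu : ringOfIntegersComplexConj K α = α * u) {d : 𝓞 (maximalRealSubfield K)}
    (hd : algebraMap (𝓞 (maximalRealSubfield K)) (𝓞 K) d = α * ringOfIntegersComplexConj K α)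
    (h𝔞 : 𝔞 ^ 2 = Ideal.span {d}) :
    𝔞.map (algebraMap (𝓞 (maximalRealSubfield K)) (𝓞 K)) = Ideal.span {α} := by
  apply ideal_eq_of_sq_eq
  rw [← Ideal.map_pow, h𝔞, Ideal.map_span, Set.image_singleton, hd, hu, ← mul_assoc,
    Ideal.span_singleton_pow, pow_two, Ideal.span_singleton_mul_right_unit u.isUnit]

omit [IsCMField K] in
/-- A root of unity of `K` that is not the square of a root of unity (the roots of unity form a cyclic
group of even order). [folklore] -/
private theorem exists_torsion_not_sq :
    ∃ u₀ ∈ torsion K, ∀ ξ ∈ torsion K, u₀ ≠ ξ ^ 2 := by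
  by_contra h
  push Not at h
  -- every root of unity is a square: squaring is onto, hence injective, on the finite group `torsion K`
  have hsurj : Function.Surjective (fun ζ : torsion K => ζ ^ 2) := by
    intro ζ
    obtain ⟨ξ, hξ, h⟩ := h ζ ζ.2
    exact ⟨⟨ξ, hξ⟩, Subtype.ext h.symm⟩
  have hinj := Finite.injective_iff_surjective.mpr hsurj
  have hneg : (-1 : (𝓞 K)ˣ) ∈ torsion K := by
    rw [torsion, CommGroup.mem_torsion]
    exact (isOfFinOrder_iff_pow_eq_one).mpr ⟨2, two_pos, by simp⟩
  have h1 : (⟨-1, hneg⟩ : torsion K) = 1 := hinj (by simp)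
  have h2 : ((-1 : (𝓞 K)ˣ) : 𝓞 K) = ((1 : (𝓞 K)ˣ) : 𝓞 K) := congrArg (fun t : torsion K => ((t : (𝓞 K)ˣ) : 𝓞 K)) h1
  rw [Units.val_neg, Units.val_one] at h2
  -- `-1 ≠ 1` in characteristic zero
  have h3 : (2 : 𝓞 K) = 0 := by linear_combination -h2
  exact two_ne_zero h3

end Single

/-! ### §4. Lemma 16: `[L : K]` odd ⟹ `κ_K = κ_L` -/

section OddDegree

variable (K L : Type) [Field K] [NumberField K] [IsCMField K] [Field L] [NumberField L] [IsCMField L]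
  [Algebra K L]

/-- `[L⁺ : K⁺] = [L : K]` for any compatible algebra `K⁺ → L⁺`. [folklore] -/
private theorem finrank_maximalRealSubfield_eq [Algebra (maximalRealSubfield K) (maximalRealSubfield L)]
    [IsScalarTower (maximalRealSubfield K) (maximalRealSubfield L) L] :
    Module.finrank (maximalRealSubfield K) (maximalRealSubfield L) = Module.finrank K L := by
  have h1 := Module.finrank_mul_finrank (maximalRealSubfield K) K L
  have h2 := Module.finrank_mul_finrank (maximalRealSubfield K) (maximalRealSubfield L) L
  rw [Algebra.IsQuadraticExtension.finrank_eq_two (maximalRealSubfield K) K] at h1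
  rw [Algebra.IsQuadraticExtension.finrank_eq_two (maximalRealSubfield L) L] at h2
  omega

/-- The real subfield of `K` maps into the real subfield of `L`. [folklore] -/
private theorem algebraMap_mem_maximalRealSubfield (y : maximalRealSubfield K) :
    algebraMap K L y ∈ maximalRealSubfield L := by
  rw [← complexConj_eq_self_iff, Lemmermeyer1995.complexConj_algebraMap K L, complexConj_apply_eq_self]

/-- **`κ_K = 2 ⟹ κ_L = 2` for `[L : K]` odd**: a non-trivial capitulating class `c` of `K⁺` extends to
`L⁺` (along the restriction `K⁺ → L⁺` of `K → L`) to a capitulating class, non-trivial because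
`N_{L⁺/K⁺}(ι c) = c^{[L:K]} = c` (`c² = 1`). [cite: Okazaki2000, §3 Lemma 16] -/
theorem IsCMField.ker_classGroupExtend_ne_bot_of_odd (hodd : Odd (Module.finrank K L))
    (hK : (classGroupExtend (maximalRealSubfield K) K).ker ≠ ⊥) :
    (classGroupExtend (maximalRealSubfield L) L).ker ≠ ⊥ := by
  obtain ⟨⟨c, hc⟩, hc1⟩ := Subgroup.ne_bot_iff_exists_ne_one.mp hK
  have hc1' : c ≠ 1 := fun h => hc1 (Subtype.ext h)
  rw [MonoidHom.mem_ker] at hc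
  -- the algebra `K⁺ → L⁺`
  let f : maximalRealSubfield K →+* maximalRealSubfield L :=
    ((algebraMap K L).comp (maximalRealSubfield K).subtype).codRestrict (maximalRealSubfield L)
      (fun y => algebraMap_mem_maximalRealSubfield K L y)
  letI : Algebra (maximalRealSubfield K) (maximalRealSubfield L) := f.toAlgebra
  haveI : IsScalarTower (maximalRealSubfield K) (maximalRealSubfield L) L :=
    IsScalarTower.of_algebraMap_eq fun y => rfl
  refine Subgroup.ne_bot_iff_exists_ne_one.mpr
    ⟨⟨classGroupExtend (maximalRealSubfield K) (maximalRealSubfield L) c, ?_⟩, ?_⟩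
  · rw [MonoidHom.mem_ker, classGroupExtend_classGroupExtend,
      ← classGroupExtend_classGroupExtend K L c, hc, map_one]
  · intro h1
    have h1' : classGroupExtend (maximalRealSubfield K) (maximalRealSubfield L) (c : ClassGroup _) = 1 :=
      congrArg Subtype.val h1
    have hN := classGroupNorm_classGroupExtend (maximalRealSubfield K) (maximalRealSubfield L)
      (c : ClassGroup (𝓞 (maximalRealSubfield K)))
    rw [h1', map_one, finrank_maximalRealSubfield_eq K L] at hN
    obtain ⟨m, hm⟩ := hodd
    have hsq := sq_eq_one_of_classGroupExtend_eq_one K hc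
    apply hc1'
    rw [hm, pow_succ, pow_mul, hsq, one_pow, one_mul] at hN
    exact hN.symm

omit [IsCMField K] in
/-- `conj (conj x) = x` on `𝓞 K`. [folklore] -/
private theorem conj_conj' [IsCMField K] (x : 𝓞 K) :
    ringOfIntegersComplexConj K (ringOfIntegersComplexConj K x) = x :=
  RingOfIntegers.ext (by rw [coe_ringOfIntegersComplexConj, coe_ringOfIntegersComplexConj,
    complexConj_apply_apply])

/-- **`κ_L = 2 ⟹ κ_K = 2` for `[L : K]` odd** (the descent): from a non-principal `𝔅 ⊆ 𝓞 L⁺` with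
`𝔅𝓞_L = (α)`, `ᾱ = α u₀` (`u₀` a non-square root of unity OF `K`, after adjusting `α` by a unit —
possible since `Q_L = 1`), the ideal `𝔞 = N_{L⁺/K⁺}(𝔅)` has `𝔞² = (N(αᾱ))` and
`𝔞𝓞_K = (β)`, `β = N_{L/K}(α) u₀^m`, `β̄ = β u₀`; it is not principal since `u₀ ∉ φ(E_K)` (`Q_K = Q_L = 1`,
the tree's `Lemmermeyer1995_unitIndex_eq_of_odd_degree`). [cite: Okazaki2000, §3 Lemma 16] -/
theorem IsCMField.ker_classGroupExtend_ne_bot_of_odd' (hodd : Odd (Module.finrank K L))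
    (hL : (classGroupExtend (maximalRealSubfield L) L).ker ≠ ⊥) :
    (classGroupExtend (maximalRealSubfield K) K).ker ≠ ⊥ := by
  classical
  obtain ⟨m, hm⟩ := id hodd
  -- unit indices: `Q_L = 1` (else `ι_L` is injective), hence `Q_K = 1`
  have hQL : indexRealUnits L = 1 := by
    rcases indexRealUnits_eq_one_or_two L with h | h
    · exact h
    · exact absurd ((MonoidHom.ker_eq_bot_iff _).mpr
        (classGroupExtend_injective_of_indexRealUnits_eq_two L h)) hL
  have hQK : indexRealUnits K = 1 := by
    rw [← Lemmermeyer1995_unitIndex_eq_of_odd_degree_holds K L hodd, hQL]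
  -- a non-square root of unity `u₀` of `K`: not in `φ(E_K)`, and its image not in `φ(E_L)`
  obtain ⟨u₀, hu₀t, hu₀⟩ := exists_torsion_not_sq K
  have hu₀K : (⟨u₀, hu₀t⟩ : torsion K) ∉ (unitsMulComplexConjInv K).range := by
    rintro ⟨η, hη⟩
    obtain ⟨r, hr⟩ := (Lemmermeyer1995.indexRealUnits_eq_one_iff K).mp hQK η
    rw [hη] at hr
    exact hu₀ r r.2 (by rw [pow_two]; exact congrArg Subtype.val hr)
  set uL : (𝓞 L)ˣ := Units.map (algebraMap (𝓞 K) (𝓞 L) : 𝓞 K →* 𝓞 L) u₀ with huL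
  have huLt : uL ∈ torsion L := by
    rw [torsion, CommGroup.mem_torsion] at hu₀t ⊢
    exact (Units.map (algebraMap (𝓞 K) (𝓞 L) : 𝓞 K →* 𝓞 L)).isOfFinOrder hu₀t
  have huLL : (⟨uL, huLt⟩ : torsion L) ∉ (unitsMulComplexConjInv L).range := by
    rintro ⟨η, hη⟩
    obtain ⟨r, hr⟩ := (Lemmermeyer1995.indexRealUnits_eq_one_iff L).mp hQL η
    rw [hη] at hr
    obtain ⟨ξ, hξ, hξu⟩ := exists_torsion_sq_eq_of_odd K L hodd u₀
      ⟨r, r.2, by rw [pow_two]; exact congrArg Subtype.val hr⟩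
    exact hu₀ ξ hξ hξu
  -- a non-principal `𝔅 ⊆ 𝓞 L⁺` with `𝔅𝓞_L = (α)`, `ᾱ = α u`, `u ∉ φ(E_L)`
  obtain ⟨⟨c, hc⟩, hc1⟩ := Subgroup.ne_bot_iff_exists_ne_one.mp hL
  have hc1' : c ≠ 1 := fun h => hc1 (Subtype.ext h)
  rw [MonoidHom.mem_ker] at hc
  obtain ⟨𝔅, h𝔅, α, rfl, hα, hα0⟩ := exists_rep_of_mem_ker L hc
  obtain ⟨u, hut, hu⟩ := exists_torsion_conj_generator L hα hα0
  have h𝔅np : ¬ 𝔅.IsPrincipal := fun hp => hc1' ((ClassGroup.mk0_eq_one_iff _).mpr hp)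
  have huL' : (⟨u, hut⟩ : torsion L) ∉ (unitsMulComplexConjInv L).range :=
    fun hmem => h𝔅np (IsCMField.isPrincipal_of_mem_range L hα hut hu hmem)
  -- re-choose `α` so that `ᾱ = α · uL`: `u · uL⁻¹ = φ(ε)` (the range has index `2`)
  have hidx : (unitsMulComplexConjInv L).range.index = 2 := by
    have h := indexRealUnits_mul_eq L
    rwa [hQL, one_mul] at h
  have hmem : (⟨u, hut⟩ : torsion L) * (⟨uL, huLt⟩ : torsion L)⁻¹ ∈
      (unitsMulComplexConjInv L).range := by
    rw [Subgroup.mul_mem_iff_of_index_two hidx]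
    exact ⟨fun h => absurd h huL', fun h => absurd (inv_mem_iff.mp h) huLL⟩
  obtain ⟨ε, hε⟩ := hmem
  have hεconj : unitsComplexConj L ε = ε * uL * u⁻¹ := by
    have h := congrArg (fun t : torsion L => (t : (𝓞 L)ˣ)) hε
    simp only [unitsMulComplexConjInv_apply, Subgroup.coe_mul, Subgroup.coe_inv] at h
    -- `h : ε * (unitsComplexConj L ε)⁻¹ = u * uL⁻¹`
    calc unitsComplexConj L ε = (ε * (unitsComplexConj L ε)⁻¹)⁻¹ * ε := by
            rw [mul_inv_rev, inv_inv, mul_assoc, inv_mul_cancel, mul_one]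
      _ = (u * uL⁻¹)⁻¹ * ε := by rw [h]
      _ = ε * uL * u⁻¹ := by rw [mul_inv_rev, inv_inv, mul_comm, mul_assoc]
  set α' : 𝓞 L := α * (ε : 𝓞 L) with hα'
  have hα'span : 𝔅.map (algebraMap (𝓞 (maximalRealSubfield L)) (𝓞 L)) = Ideal.span {α'} := by
    rw [hα, hα', Ideal.span_singleton_mul_right_unit ε.isUnit]
  have hα'0 : α' ≠ 0 := mul_ne_zero hα0 (Units.ne_zero ε)
  have hα'conj : ringOfIntegersComplexConj L α' = α' * uL := by
    rw [hα', map_mul, hu, ← coe_unitsComplexConj' L, hεconj, Units.val_mul, Units.val_mul]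
    linear_combination (α * (ε : 𝓞 L) * (uL : 𝓞 L)) * (Units.mul_inv u)
  -- the element `d_L = α' ᾱ'` of `𝓞 L⁺` and `𝔅² = (d_L)`
  have hfixL : ringOfIntegersComplexConj L (α' * ringOfIntegersComplexConj L α') =
      α' * ringOfIntegersComplexConj L α' := by
    rw [map_mul, conj_conj' L, mul_comm]
  obtain ⟨dL, hdL⟩ := (ringOfIntegersComplexConj_eq_self_iff L _).mp hfixL
  have h𝔅sq : 𝔅 ^ 2 = Ideal.span {dL} := IsCMField.sq_eq_span_of_map_eq_span L hα'span hα'conj hdL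
  -- norms down to `K`: `β = N_{L/K}(α') u₀^m`, `β̄ = β u₀`
  set β₀ : 𝓞 K := RingOfIntegers.norm K α' with hβ₀
  set β : 𝓞 K := β₀ * ((u₀ ^ m : (𝓞 K)ˣ) : 𝓞 K) with hβ
  have hβ₀0 : β₀ ≠ 0 := by
    intro h0
    have h1 : ((β₀ : 𝓞 K) : K) = 0 := by rw [h0]; rfl
    rw [hβ₀, RingOfIntegers.coe_norm, Algebra.norm_eq_zero_iff] at h1
    exact hα'0 (RingOfIntegers.coe_eq_zero_iff.mp h1)
  have hβ0 : β ≠ 0 := mul_ne_zero hβ₀0 (Units.ne_zero _)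
  have hu₀K0 : ((u₀ : 𝓞 K) : K) ≠ 0 := by
    exact_mod_cast Units.ne_zero u₀
  have hcu₀ : complexConj K ((u₀ : 𝓞 K) : K) = ((u₀ : 𝓞 K) : K)⁻¹ := complexConj_torsion K ⟨u₀, hu₀t⟩
  have huLcoe : ((uL : 𝓞 L) : L) = algebraMap K L ((u₀ : 𝓞 K) : K) := rfl
  -- `conj β₀ = β₀ u₀^{[L:K]}` (in `K`)
  have hconjβ₀ : complexConj K (β₀ : K) = (β₀ : K) * ((u₀ : 𝓞 K) : K) ^ Module.finrank K L := by
    rw [hβ₀, RingOfIntegers.coe_norm, ← Lemmermeyer1995.norm_complexConj K L,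
      ← coe_ringOfIntegersComplexConj, hα'conj]
    change Algebra.norm K ((α' : L) * ((uL : 𝓞 L) : L)) = _
    rw [map_mul, huLcoe, Algebra.norm_algebraMap]
  have hxc : (((u₀ : 𝓞 K) : K) * complexConj K ((u₀ : 𝓞 K) : K)) ^ m = 1 := by
    rw [hcu₀, mul_inv_cancel₀ hu₀K0, one_pow]
  have hconjβ : ringOfIntegersComplexConj K β = β * u₀ := by
    apply RingOfIntegers.ext
    rw [coe_ringOfIntegersComplexConj, hβ]
    push_cast
    rw [map_mul, hconjβ₀, map_pow, hm]
    linear_combination ((β₀ : K) * ((u₀ : 𝓞 K) : K) ^ m * ((u₀ : 𝓞 K) : K)) * hxc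
  -- `d_K = N_{L⁺/K⁺}(d_L)` and `𝔞 = N_{L⁺/K⁺}(𝔅)`: `𝔞² = (d_K)`, `d_K = β β̄` (base change of norms, §2)
  let f : maximalRealSubfield K →+* maximalRealSubfield L :=
    ((algebraMap K L).comp (maximalRealSubfield K).subtype).codRestrict (maximalRealSubfield L)
      (fun y => algebraMap_mem_maximalRealSubfield K L y)
  letI : Algebra (maximalRealSubfield K) (maximalRealSubfield L) := f.toAlgebra
  haveI : IsScalarTower (maximalRealSubfield K) (maximalRealSubfield L) L :=
    IsScalarTower.of_algebraMap_eq fun y => rfl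
  set 𝔞 : Ideal (𝓞 (maximalRealSubfield K)) := Ideal.relNorm (𝓞 (maximalRealSubfield K)) 𝔅 with h𝔞def
  set dK : 𝓞 (maximalRealSubfield K) :=
    Algebra.intNorm (𝓞 (maximalRealSubfield K)) (𝓞 (maximalRealSubfield L)) dL with hdKdef
  have h𝔞sq : 𝔞 ^ 2 = Ideal.span {dK} := by
    rw [h𝔞def, ← map_pow, h𝔅sq, Ideal.relNorm_singleton]
  have hdK : algebraMap (𝓞 (maximalRealSubfield K)) (𝓞 K) dK = β * ringOfIntegersComplexConj K β := by
    apply RingOfIntegers.ext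
    -- in `K`: `N_{L⁺/K⁺}(d_L) = N_{L/K}(d_L) = N(α') N(ᾱ') = β₀ β̄₀ = β β̄`
    change algebraMap (maximalRealSubfield K) K
        (algebraMap (𝓞 (maximalRealSubfield K)) (maximalRealSubfield K) dK) =
      (β : K) * complexConj K (β : K)
    have h2 : algebraMap (maximalRealSubfield L) L
        (algebraMap (𝓞 (maximalRealSubfield L)) (maximalRealSubfield L) dL) =
          (α' : L) * complexConj L (α' : L) := by
      change ((algebraMap (𝓞 (maximalRealSubfield L)) (𝓞 L) dL : 𝓞 L) : L) = _
      rw [hdL]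
      rfl
    rw [hdKdef, Algebra.algebraMap_intNorm (A := 𝓞 (maximalRealSubfield K))
      (K := maximalRealSubfield K) (L := maximalRealSubfield L) (B := 𝓞 (maximalRealSubfield L)) dL,
      IsCMField.algebraMap_norm_eq_norm K L, h2, map_mul, Lemmermeyer1995.norm_complexConj K L,
      ← RingOfIntegers.coe_norm, ← hβ₀, hβ]
    push_cast
    rw [map_mul, map_pow]
    linear_combination (-((β₀ : K) * complexConj K (β₀ : K))) * hxc
  -- `𝔞𝓞_K = (β)`, and `𝔞` is not principal
  have h𝔞map : 𝔞.map (algebraMap (𝓞 (maximalRealSubfield K)) (𝓞 K)) = Ideal.span {β} :=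
    IsCMField.map_eq_span_of_sq_eq_span K hconjβ hdK h𝔞sq
  have h𝔞np : ¬ 𝔞.IsPrincipal := fun hp =>
    hu₀K (IsCMField.mem_range_of_isPrincipal K h𝔞map hβ0 hu₀t hconjβ hp)
  have h𝔞0 : 𝔞 ≠ ⊥ := by
    intro h0
    apply hβ0
    have h1 : Ideal.span {β} = ⊥ := by
      rw [← h𝔞map, h0, Ideal.map_bot]
    exact Ideal.span_singleton_eq_bot.mp h1
  refine Subgroup.ne_bot_iff_exists_ne_one.mpr
    ⟨⟨ClassGroup.mk0 ⟨𝔞, mem_nonZeroDivisors_of_ne_zero h𝔞0⟩, ?_⟩, ?_⟩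
  · rw [MonoidHom.mem_ker, classGroupExtend_mk0, ClassGroup.mk0_eq_one_iff]
    change (𝔞.map (algebraMap (𝓞 (maximalRealSubfield K)) (𝓞 K))).IsPrincipal
    rw [h𝔞map]
    exact ⟨⟨β, rfl⟩⟩
  · intro h
    exact h𝔞np ((ClassGroup.mk0_eq_one_iff _).mp (congrArg Subtype.val h))

/-- **Okazaki's Lemma 16, capitulation half: `[L : K]` odd ⟹ `κ_K = κ_L`** (`κ_F = #ker(C_{F⁺} → C_F)`).
[cite: Okazaki2000, §3 Lemma 16] -/
theorem IsCMField.card_ker_classGroupExtend_eq_of_odd (hodd : Odd (Module.finrank K L)) :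
    Nat.card (classGroupExtend (maximalRealSubfield K) K).ker =
      Nat.card (classGroupExtend (maximalRealSubfield L) L).ker := by
  rcases card_ker_classGroupExtend_eq_one_or_two K with hK | hK <;>
    rcases card_ker_classGroupExtend_eq_one_or_two L with hL | hL
  · rw [hK, hL]
  · exfalso
    have hLne : (classGroupExtend (maximalRealSubfield L) L).ker ≠ ⊥ := by
      rw [Ne, ← Subgroup.card_eq_one, hL]; norm_num
    have hKeq : (classGroupExtend (maximalRealSubfield K) K).ker = ⊥ := Subgroup.card_eq_one.mp hK
    exact IsCMField.ker_classGroupExtend_ne_bot_of_odd' K L hodd hLne hKeq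
  · exfalso
    have hKne : (classGroupExtend (maximalRealSubfield K) K).ker ≠ ⊥ := by
      rw [Ne, ← Subgroup.card_eq_one, hK]; norm_num
    have hLeq : (classGroupExtend (maximalRealSubfield L) L).ker = ⊥ := Subgroup.card_eq_one.mp hL
    exact IsCMField.ker_classGroupExtend_ne_bot_of_odd K L hodd hKne hLeq
  · rw [hK, hL]

/-- **Okazaki's Lemma 16 for `[L : K]` odd, as printed: `κ_K = κ_L` and `Q_K = Q_L`** (the unit-index
half is the tree's discharged `Lemmermeyer1995_unitIndex_eq_of_odd_degree`, Hirabayashi–Yoshino /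
Lemmermeyer Prop. 1 f)). [cite: Okazaki2000, §3 Lemma 16] [cite: Lemmermeyer1995, §2 Proposition 1 f)] -/
theorem IsCMField.card_ker_classGroupExtend_eq_and_indexRealUnits_eq_of_odd
    (hodd : Odd (Module.finrank K L)) :
    Nat.card (classGroupExtend (maximalRealSubfield K) K).ker =
        Nat.card (classGroupExtend (maximalRealSubfield L) L).ker ∧
      indexRealUnits K = indexRealUnits L :=
  ⟨IsCMField.card_ker_classGroupExtend_eq_of_odd K L hodd,
    (Lemmermeyer1995_unitIndex_eq_of_odd_degree_holds K L hodd).symm⟩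

end OddDegree

/-! ### §5. Lemma 16, second divisibility: `Q_k w_k ∣ Q_K w_K` for every pair of CM fields -/

section UnitIndex

variable (K L : Type) [Field K] [NumberField K] [IsCMField K] [Field L] [NumberField L] [IsCMField L]
  [Algebra K L]

/-- `Q_F · w_F = 2 · #φ(E_F)` for a CM field (`[W_F : φ(E_F)] · Q_F = 2`, Mathlib `indexRealUnits_mul_eq`).
[cite: Okazaki2000, §3 (definitions of `Q_F`, `w_F`) and Lemma 14] -/
theorem IsCMField.indexRealUnits_mul_torsionOrder (F : Type) [Field F] [NumberField F] [IsCMField F] :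
    indexRealUnits F * torsionOrder F = 2 * Nat.card (unitsMulComplexConjInv F).range := by
  rw [← indexRealUnits_mul_eq F, torsionOrder, ← Subgroup.card_mul_index (unitsMulComplexConjInv F).range]
  ring

/-- **Okazaki's Lemma 16, second divisibility: `Q_K w_K ∣ Q_L w_L`** for CM fields `K ⊆ L` (any degree):
`φ(E_K) ↪ φ(E_L)` along `E_K → E_L` (`φ(ε) = ε/ε̄` commutes with the inclusion), and `Q w = 2 #φ(E)`.
[cite: Okazaki2000, §3 Lemma 16] [cite: Lemmermeyer1995, §2 Proposition 1 d)] -/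
theorem IsCMField.indexRealUnits_mul_torsionOrder_dvd :
    indexRealUnits K * torsionOrder K ∣ indexRealUnits L * torsionOrder L := by
  rw [IsCMField.indexRealUnits_mul_torsionOrder K, IsCMField.indexRealUnits_mul_torsionOrder L]
  refine Nat.mul_dvd_mul_left 2 ?_
  -- the injection `W_K → W_L` restricted to `φ(E_K) → φ(E_L)`
  let ι : torsion K →* torsion L :=
    ((Units.map (algebraMap (𝓞 K) (𝓞 L) : 𝓞 K →* 𝓞 L)).restrict (torsion K)).codRestrict
      (torsion L) fun ζ ↦ by
        have h : IsOfFinOrder (ζ : (𝓞 K)ˣ) := ζ.2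
        exact (Units.map (algebraMap (𝓞 K) (𝓞 L) : 𝓞 K →* 𝓞 L)).isOfFinOrder h
  have hι : Function.Injective ι := by
    intro ζ₁ ζ₂ h
    apply Subtype.ext
    apply Units.ext
    apply (FaithfulSMul.algebraMap_injective (𝓞 K) (𝓞 L))
    have h' := congrArg (fun t : torsion L => ((t : (𝓞 L)ˣ) : 𝓞 L)) h
    simpa [ι] using h'
  have hmap : ((unitsMulComplexConjInv K).range).map ι ≤ (unitsMulComplexConjInv L).range := by
    rintro _ ⟨_, ⟨u, rfl⟩, rfl⟩
    exact ⟨Units.map (algebraMap (𝓞 K) (𝓞 L) : 𝓞 K →* 𝓞 L) u,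
      Subtype.ext (Lemmermeyer1995.unitsMap_unitsMulComplexConjInv K L u).symm⟩
  rw [← Subgroup.card_map_of_injective hι]
  exact Subgroup.card_dvd_of_le hmap

end UnitIndex

/-! ### §6. Lemma 16, first divisibility: `κ_k Q_k w_k ∣ κ_K Q_K w_K` for every pair of CM fields

The «characterization of `κ_F` and `Q_F`» of Washington's Thm. 10.3 (proof): the roots of unity `ᾱ/α`
attached to the generators of extended ideals, `U_F = {u ∈ W_F : ∃ 𝔞 ⊆ 𝓞_{F⁺}, ∃ α ≠ 0, 𝔞𝓞_F = (α),
ᾱ = α u}`, form a subgroup of `W_F` containing `φ(E_F)` (`𝔞 = (1)`, `α = ε̄`), and `ᾱ/α ↦ [𝔞]` is a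
well-defined homomorphism `U_F → C_{F⁺}` (two generators with the same root of unity give classes
`[𝔞], [𝔟]` with `𝔞𝔟` principal) onto `ker(C_{F⁺} → C_F)` with kernel `φ(E_F)`.  Hence
`#U_F = κ_F · #φ(E_F) = κ_F Q_F w_F / 2`; and `U_k ↪ U_K` along `W_k ↪ W_K`.  The subgroup `U_F` enters
the statements only through its membership predicate (no definition is introduced). -/

section WashingtonGroup

variable (K : Type) [Field K] [NumberField K] [IsCMField K]

omit [NumberField K] [IsCMField K] in
/-- If `𝔞𝓞_K = (α)` with `α ≠ 0` then `𝔞 ≠ 0`. [folklore] -/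
private theorem ne_bot_of_map_eq_span {𝔞 : Ideal (𝓞 (maximalRealSubfield K))} {α : 𝓞 K}
    (hα : 𝔞.map (algebraMap (𝓞 (maximalRealSubfield K)) (𝓞 K)) = Ideal.span {α}) (hα0 : α ≠ 0) :
    𝔞 ≠ ⊥ := by
  rintro rfl
  rw [Ideal.map_bot, eq_comm, Ideal.span_singleton_eq_bot] at hα
  exact hα0 hα

/-- **Two principal generators with the same root of unity `ᾱ/α = β̄/β` generate extended ideals of the
same class of `K⁺`**: `γ = α β̄` is conjugation-fixed and generates `𝔞𝔟𝓞_K`, so `𝔞𝔟` is principal,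
`[𝔞][𝔟] = 1 = [𝔟]²`, `[𝔞] = [𝔟]` (the well-definedness of Washington's injection
`ker(C_{K⁺} → C_K) ↪ W/φ(E)`, read backwards). [cite: Washington1997, Thm. 10.3 (proof)]
[cite: Okazaki2000, §3 Lemma 16 (proof, «a characterization of κ_F and Q_F»)] -/
theorem IsCMField.mk0_eq_mk0_of_conj_eq_mul {𝔞 𝔟 : Ideal (𝓞 (maximalRealSubfield K))} {α β : 𝓞 K}
    (h𝔞 : 𝔞 ∈ (Ideal (𝓞 (maximalRealSubfield K)))⁰) (h𝔟 : 𝔟 ∈ (Ideal (𝓞 (maximalRealSubfield K)))⁰)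
    (hα : 𝔞.map (algebraMap (𝓞 (maximalRealSubfield K)) (𝓞 K)) = Ideal.span {α})
    (hβ : 𝔟.map (algebraMap (𝓞 (maximalRealSubfield K)) (𝓞 K)) = Ideal.span {β}) {u : (𝓞 K)ˣ}
    (hαu : ringOfIntegersComplexConj K α = α * u) (hβu : ringOfIntegersComplexConj K β = β * u) :
    ClassGroup.mk0 ⟨𝔞, h𝔞⟩ = ClassGroup.mk0 ⟨𝔟, h𝔟⟩ := by
  -- `γ = α β̄` is conjugation-fixed and generates `𝔞𝔟𝓞_K`
  set γ : 𝓞 K := α * ringOfIntegersComplexConj K β with hγ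
  have hfix : ringOfIntegersComplexConj K γ = γ := by
    rw [hγ, map_mul, conj_conj' K, hαu, hβu]
    ring
  have hspan : (𝔞 * 𝔟).map (algebraMap (𝓞 (maximalRealSubfield K)) (𝓞 K)) = Ideal.span {γ} := by
    rw [Ideal.map_mul, hα, hβ, hγ, hβu, ← Ideal.span_singleton_mul_span_singleton,
      Ideal.span_singleton_mul_right_unit u.isUnit]
  have hprin : (𝔞 * 𝔟).IsPrincipal := isPrincipal_of_map_eq_span_of_conj_eq K hspan hfix
  -- `[𝔞][𝔟] = 1`
  have hmul : ClassGroup.mk0 ⟨𝔞, h𝔞⟩ * ClassGroup.mk0 ⟨𝔟, h𝔟⟩ = 1 := by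
    rw [← map_mul]
    have : (⟨𝔞, h𝔞⟩ * ⟨𝔟, h𝔟⟩ : (Ideal (𝓞 (maximalRealSubfield K)))⁰) =
        ⟨𝔞 * 𝔟, mul_mem h𝔞 h𝔟⟩ := rfl
    rw [this, ClassGroup.mk0_eq_one_iff]
    exact hprin
  -- `[𝔟]² = 1` (a capitulating class)
  have h𝔟1 : classGroupExtend (maximalRealSubfield K) K (ClassGroup.mk0 ⟨𝔟, h𝔟⟩) = 1 := by
    rw [classGroupExtend_mk0, ClassGroup.mk0_eq_one_iff]
    change (𝔟.map (algebraMap (𝓞 (maximalRealSubfield K)) (𝓞 K))).IsPrincipal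
    rw [hβ]
    exact ⟨⟨β, rfl⟩⟩
  have hsq := sq_eq_one_of_classGroupExtend_eq_one K h𝔟1
  rw [pow_two] at hsq
  rw [eq_inv_of_mul_eq_one_left hmul, ← eq_inv_of_mul_eq_one_left hsq]

/-- **The roots of unity `ᾱ/α` (`𝔞𝓞_K = (α)`, `𝔞 ⊆ 𝓞_{K⁺}`, `α ≠ 0`) form a subgroup `U_K` of `W_K`**
(products: `(𝔞𝔟, αβ)`; inverses: `(𝔞, ᾱ)`). [cite: Washington1997, Thm. 10.3 (proof)]
[cite: Okazaki2000, §3 Lemma 16 (proof)] -/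
theorem IsCMField.exists_subgroup_torsion_mem_iff :
    ∃ U : Subgroup (torsion K), ∀ ζ : torsion K, ζ ∈ U ↔
      ∃ (𝔞 : Ideal (𝓞 (maximalRealSubfield K))) (α : 𝓞 K), α ≠ 0 ∧
        𝔞.map (algebraMap (𝓞 (maximalRealSubfield K)) (𝓞 K)) = Ideal.span {α} ∧
        ringOfIntegersComplexConj K α = α * ((ζ : (𝓞 K)ˣ) : 𝓞 K) := by
  refine ⟨{ carrier := {ζ | ∃ (𝔞 : Ideal (𝓞 (maximalRealSubfield K))) (α : 𝓞 K), α ≠ 0 ∧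
              𝔞.map (algebraMap (𝓞 (maximalRealSubfield K)) (𝓞 K)) = Ideal.span {α} ∧
              ringOfIntegersComplexConj K α = α * ((ζ : (𝓞 K)ˣ) : 𝓞 K)}
            mul_mem' := ?_, one_mem' := ?_, inv_mem' := ?_ }, fun ζ => Iff.rfl⟩
  · rintro ζ₁ ζ₂ ⟨𝔞₁, α₁, h₁0, h₁, h₁c⟩ ⟨𝔞₂, α₂, h₂0, h₂, h₂c⟩
    refine ⟨𝔞₁ * 𝔞₂, α₁ * α₂, mul_ne_zero h₁0 h₂0, ?_, ?_⟩
    · rw [Ideal.map_mul, h₁, h₂, Ideal.span_singleton_mul_span_singleton]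
    · rw [map_mul, h₁c, h₂c, Subgroup.coe_mul, Units.val_mul]
      ring
  · refine ⟨⊤, 1, one_ne_zero, ?_, ?_⟩
    · rw [Ideal.map_top, Ideal.span_singleton_one]
    · rw [map_one, Subgroup.coe_one, Units.val_one, mul_one]
  · rintro ζ ⟨𝔞, α, h0, h, hc⟩
    refine ⟨𝔞, ringOfIntegersComplexConj K α, ?_, ?_, ?_⟩
    · exact (map_ne_zero_iff _ (ringOfIntegersComplexConj K).injective).mpr h0
    · rw [h, hc, Ideal.span_singleton_mul_right_unit (ζ : (𝓞 K)ˣ).isUnit]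
    · rw [conj_conj' K, hc, Subgroup.coe_inv, mul_assoc, Units.mul_inv, mul_one]

variable {K} in
/-- `φ(E_K) ⊆ U_K`: `φ(ε) = ε/ε̄` is the root of unity attached to `α = ε̄`, `𝔞 = (1)`.
[cite: Washington1997, Thms. 4.12 and 10.3 (proofs)] [cite: Okazaki2000, §3 Lemma 16 (proof)] -/
theorem IsCMField.range_unitsMulComplexConjInv_le_of_mem_iff {U : Subgroup (torsion K)}
    (hU : ∀ ζ : torsion K, ζ ∈ U ↔
      ∃ (𝔞 : Ideal (𝓞 (maximalRealSubfield K))) (α : 𝓞 K), α ≠ 0 ∧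
        𝔞.map (algebraMap (𝓞 (maximalRealSubfield K)) (𝓞 K)) = Ideal.span {α} ∧
        ringOfIntegersComplexConj K α = α * ((ζ : (𝓞 K)ˣ) : 𝓞 K)) :
    (unitsMulComplexConjInv K).range ≤ U := by
  rintro _ ⟨η, rfl⟩
  rw [hU]
  refine ⟨⊤, ((unitsComplexConj K η : (𝓞 K)ˣ) : 𝓞 K), Units.ne_zero _, ?_, ?_⟩
  · rw [Ideal.map_top, eq_comm, Ideal.span_singleton_eq_top]
    exact Units.isUnit _
  · -- `\bar{ε̄} = ε = ε̄ · (ε/ε̄)` in `(𝓞 K)ˣ`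
    have h1 : unitsComplexConj K (unitsComplexConj K η) = η :=
      Units.ext (by rw [coe_unitsComplexConj' K, coe_unitsComplexConj' K, conj_conj' K])
    have h2 : unitsComplexConj K (unitsComplexConj K η) =
        unitsComplexConj K η * (unitsMulComplexConjInv K η : (𝓞 K)ˣ) := by
      rw [h1, unitsMulComplexConjInv_apply, mul_left_comm, mul_inv_cancel, mul_one]
    rw [← coe_unitsComplexConj' K, h2, Units.val_mul]

variable {K} in
/-- **`#U_K = κ_K · #φ(E_K)`** (`κ_K = #ker(C_{K⁺} → C_K)`, `φ(E_K) = {ε/ε̄}`): `ᾱ/α ↦ [𝔞]` is a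
homomorphism `U_K → C_{K⁺}` onto the capitulation kernel (every capitulating `𝔞` has `𝔞𝓞_K = (α)`,
`ᾱ = αu`, `u ∈ W_K` — `exists_torsion_conj_generator`) with kernel `φ(E_K)` (`𝔞` is principal iff
`ᾱ/α ∈ φ(E_K)` — `IsCMField.isPrincipal_of_mem_range`, `IsCMField.mem_range_of_isPrincipal`).
[cite: Washington1997, Thm. 10.3 (proof)] [cite: Okazaki2000, §3 Lemma 16 (proof, «a characterization of κ_F and Q_F»)] -/
theorem IsCMField.card_eq_card_ker_mul_card_range_of_mem_iff {U : Subgroup (torsion K)}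
    (hU : ∀ ζ : torsion K, ζ ∈ U ↔
      ∃ (𝔞 : Ideal (𝓞 (maximalRealSubfield K))) (α : 𝓞 K), α ≠ 0 ∧
        𝔞.map (algebraMap (𝓞 (maximalRealSubfield K)) (𝓞 K)) = Ideal.span {α} ∧
        ringOfIntegersComplexConj K α = α * ((ζ : (𝓞 K)ˣ) : 𝓞 K)) :
    Nat.card U = Nat.card (classGroupExtend (maximalRealSubfield K) K).ker *
      Nat.card (unitsMulComplexConjInv K).range := by
  classical
  -- witnesses `(𝔞 ζ, α ζ)` for the members of `U`
  have hmem : ∀ ζ : U, ∃ (𝔞 : Ideal (𝓞 (maximalRealSubfield K))) (α : 𝓞 K), α ≠ 0 ∧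
      𝔞.map (algebraMap (𝓞 (maximalRealSubfield K)) (𝓞 K)) = Ideal.span {α} ∧
      ringOfIntegersComplexConj K α = α * (((ζ : torsion K) : (𝓞 K)ˣ) : 𝓞 K) :=
    fun ζ => (hU ζ).mp ζ.2
  choose 𝔞 α hα0 hα hconj using hmem
  have h𝔞0 : ∀ ζ : U, 𝔞 ζ ∈ (Ideal (𝓞 (maximalRealSubfield K)))⁰ := fun ζ =>
    mem_nonZeroDivisors_of_ne_zero (ne_bot_of_map_eq_span K (hα ζ) (hα0 ζ))
  -- the homomorphism `g : U → C_{K⁺}`, `ζ ↦ [𝔞 ζ]`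
  let g : U →* ClassGroup (𝓞 (maximalRealSubfield K)) :=
    MonoidHom.mk' (fun ζ => ClassGroup.mk0 ⟨𝔞 ζ, h𝔞0 ζ⟩) fun ζ₁ ζ₂ => by
      -- `(𝔞 ζ₁ · 𝔞 ζ₂, α ζ₁ · α ζ₂)` is another witness for `ζ₁ ζ₂`
      have hw : (𝔞 ζ₁ * 𝔞 ζ₂).map (algebraMap (𝓞 (maximalRealSubfield K)) (𝓞 K)) =
          Ideal.span {α ζ₁ * α ζ₂} := by
        rw [Ideal.map_mul, hα, hα, Ideal.span_singleton_mul_span_singleton]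
      have hwc : ringOfIntegersComplexConj K (α ζ₁ * α ζ₂) =
          α ζ₁ * α ζ₂ * ((((ζ₁ * ζ₂ : U) : torsion K) : (𝓞 K)ˣ) : 𝓞 K) := by
        rw [map_mul, hconj, hconj, Subgroup.coe_mul, Subgroup.coe_mul, Units.val_mul]
        ring
      rw [IsCMField.mk0_eq_mk0_of_conj_eq_mul K (h𝔞0 (ζ₁ * ζ₂)) (mul_mem (h𝔞0 ζ₁) (h𝔞0 ζ₂))
        (hα (ζ₁ * ζ₂)) hw (hconj (ζ₁ * ζ₂)) hwc, ← map_mul]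
      rfl
  have hg : ∀ ζ : U, g ζ = ClassGroup.mk0 ⟨𝔞 ζ, h𝔞0 ζ⟩ := fun ζ => rfl
  -- its range is the capitulation kernel
  have hrange : g.range = (classGroupExtend (maximalRealSubfield K) K).ker := by
    apply le_antisymm
    · rintro _ ⟨ζ, rfl⟩
      rw [MonoidHom.mem_ker, hg, classGroupExtend_mk0, ClassGroup.mk0_eq_one_iff]
      change ((𝔞 ζ).map (algebraMap (𝓞 (maximalRealSubfield K)) (𝓞 K))).IsPrincipal
      rw [hα]
      exact ⟨⟨α ζ, rfl⟩⟩
    · intro c hc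
      rw [MonoidHom.mem_ker] at hc
      obtain ⟨𝔟, h𝔟, β, rfl, hβ, hβ0⟩ := exists_rep_of_mem_ker K hc
      obtain ⟨u, hut, hu⟩ := exists_torsion_conj_generator K hβ hβ0
      have hζU : (⟨u, hut⟩ : torsion K) ∈ U := (hU _).mpr ⟨𝔟, β, hβ0, hβ, hu⟩
      refine ⟨⟨⟨u, hut⟩, hζU⟩, ?_⟩
      rw [hg]
      exact IsCMField.mk0_eq_mk0_of_conj_eq_mul K (h𝔞0 _) (mem_nonZeroDivisors_of_ne_zero h𝔟) (hα _) hβ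
        (hconj _) hu
  -- its kernel is `φ(E_K)` (inside `U`)
  have hle : (unitsMulComplexConjInv K).range ≤ U :=
    IsCMField.range_unitsMulComplexConjInv_le_of_mem_iff hU
  have hker : g.ker = ((unitsMulComplexConjInv K).range).subgroupOf U := by
    ext ζ
    rw [MonoidHom.mem_ker, Subgroup.mem_subgroupOf, hg, ClassGroup.mk0_eq_one_iff]
    constructor
    · intro hprin
      exact IsCMField.mem_range_of_isPrincipal K (hα ζ) (hα0 ζ) (ζ : torsion K).2 (hconj ζ) hprin
    · intro hm
      exact IsCMField.isPrincipal_of_mem_range K (hα ζ) (ζ : torsion K).2 (hconj ζ) hm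
  -- count: `#U = #(U/ker g) · #ker g = #range g · #φ(E_K)`
  have h1 : Nat.card g.ker = Nat.card (unitsMulComplexConjInv K).range := by
    rw [hker]
    exact Nat.card_congr (Subgroup.subgroupOfEquivOfLe hle).toEquiv
  have h2 : Nat.card (U ⧸ g.ker) = Nat.card g.range :=
    Nat.card_congr (QuotientGroup.quotientKerEquivRange g).toEquiv
  rw [Subgroup.card_eq_card_quotient_mul_card_subgroup g.ker, h2, hrange, h1]

/-- **Washington's characterization, counted: there is a subgroup `U_K ≤ W_K` — the roots of unity `ᾱ/α`
of the generators of extended ideals `𝔞𝓞_K = (α)` — with `φ(E_K) ≤ U_K` and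
`2 · #U_K = κ_K · Q_K · w_K`** (`#U_K = κ_K #φ(E_K)` and `Q_K w_K = 2 #φ(E_K)`).
[cite: Washington1997, Thms. 4.12 and 10.3 (proofs)] [cite: Okazaki2000, §3 Lemma 16 (proof, «a characterization of κ_F and Q_F»)] -/
theorem IsCMField.exists_subgroup_torsion_two_mul_card_eq :
    ∃ U : Subgroup (torsion K), (∀ ζ : torsion K, ζ ∈ U ↔
        ∃ (𝔞 : Ideal (𝓞 (maximalRealSubfield K))) (α : 𝓞 K), α ≠ 0 ∧
          𝔞.map (algebraMap (𝓞 (maximalRealSubfield K)) (𝓞 K)) = Ideal.span {α} ∧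
          ringOfIntegersComplexConj K α = α * ((ζ : (𝓞 K)ˣ) : 𝓞 K)) ∧
      (unitsMulComplexConjInv K).range ≤ U ∧
      2 * Nat.card U =
        Nat.card (classGroupExtend (maximalRealSubfield K) K).ker * (indexRealUnits K * torsionOrder K) := by
  obtain ⟨U, hU⟩ := IsCMField.exists_subgroup_torsion_mem_iff K
  refine ⟨U, hU, IsCMField.range_unitsMulComplexConjInv_le_of_mem_iff hU, ?_⟩
  rw [IsCMField.card_eq_card_ker_mul_card_range_of_mem_iff hU, IsCMField.indexRealUnits_mul_torsionOrder K]
  ring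

/-- **`κ_K ∣ [W_K : φ(E_K)]` (`= 2/Q_K`)** — Washington Thm. 10.3's injection `ker(C_{K⁺} → C_K) ↪ W_K/φ(E_K)`
in counted form (`U_K/φ(E_K) ≃ ker`, `U_K ≤ W_K`); with `Q_K · [W_K : φ(E_K)] = 2` this is Okazaki's
Lemma 14 `κ_K Q_K ∣ 2`. [cite: Washington1997, Thm. 10.3] [cite: Okazaki2000, §3 Lemma 14] -/
theorem IsCMField.card_ker_classGroupExtend_dvd_index_range :
    Nat.card (classGroupExtend (maximalRealSubfield K) K).ker ∣ (unitsMulComplexConjInv K).range.index := by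
  obtain ⟨U, hU⟩ := IsCMField.exists_subgroup_torsion_mem_iff K
  have hcard := IsCMField.card_eq_card_ker_mul_card_range_of_mem_iff hU
  have hdvd : Nat.card U ∣ Nat.card (torsion K) := Subgroup.card_subgroup_dvd_card U
  rw [hcard, ← (unitsMulComplexConjInv K).range.card_mul_index, mul_comm] at hdvd
  exact Nat.dvd_of_mul_dvd_mul_left Nat.card_pos hdvd

end WashingtonGroup

section FirstDivisibility

variable (K L : Type) [Field K] [NumberField K] [IsCMField K] [Field L] [NumberField L] [IsCMField L]
  [Algebra K L]

/-- **Okazaki's Lemma 16, first divisibility: `κ_K Q_K w_K ∣ κ_L Q_L w_L`** for every pair of CM fields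
`K ⊆ L` (any degree; `κ_F = #ker(C_{F⁺} → C_F)`, `Q_F` = Hasse's unit index, `w_F = #W_F`): both sides are
`2 #U_F` for Washington's subgroups `U_F ≤ W_F`, and `U_K ↪ U_L` along `W_K ↪ W_L` (`𝔞𝓞_K = (α)`,
`ᾱ = αu` ⟹ `(𝔞𝓞_{L⁺})𝓞_L = (α)` in `L` with the same `u`, the complex conjugation of `L` restricting to
that of `K`). [cite: Okazaki2000, §3 Lemma 16] [cite: Washington1997, Thm. 10.3 (proof)] -/
theorem IsCMField.card_ker_classGroupExtend_mul_indexRealUnits_mul_torsionOrder_dvd :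
    Nat.card (classGroupExtend (maximalRealSubfield K) K).ker * (indexRealUnits K * torsionOrder K) ∣
      Nat.card (classGroupExtend (maximalRealSubfield L) L).ker * (indexRealUnits L * torsionOrder L) := by
  obtain ⟨UK, hUK, -, hK⟩ := IsCMField.exists_subgroup_torsion_two_mul_card_eq K
  obtain ⟨UL, hUL, -, hL⟩ := IsCMField.exists_subgroup_torsion_two_mul_card_eq L
  rw [← hK, ← hL]
  refine Nat.mul_dvd_mul_left 2 ?_
  -- the injection `W_K → W_L`
  let ι : torsion K →* torsion L :=
    ((Units.map (algebraMap (𝓞 K) (𝓞 L) : 𝓞 K →* 𝓞 L)).restrict (torsion K)).codRestrict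
      (torsion L) fun ζ ↦ by
        have h : IsOfFinOrder (ζ : (𝓞 K)ˣ) := ζ.2
        exact (Units.map (algebraMap (𝓞 K) (𝓞 L) : 𝓞 K →* 𝓞 L)).isOfFinOrder h
  have hι : Function.Injective ι := by
    intro ζ₁ ζ₂ h
    apply Subtype.ext
    apply Units.ext
    apply (FaithfulSMul.algebraMap_injective (𝓞 K) (𝓞 L))
    have h' := congrArg (fun t : torsion L => ((t : (𝓞 L)ˣ) : 𝓞 L)) h
    simpa [ι] using h'
  -- `ι(U_K) ≤ U_L`
  have hmap : UK.map ι ≤ UL := by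
    rintro _ ⟨ζ, hζ, rfl⟩
    rw [hUL]
    obtain ⟨𝔞, α, hα0, hα, hconj⟩ := (hUK ζ).mp hζ
    -- the algebra `K⁺ → L⁺` (restriction of `K → L`) and the towers `K⁺ → L⁺ → L`, `K⁺ → K → L`
    let f : maximalRealSubfield K →+* maximalRealSubfield L :=
      ((algebraMap K L).comp (maximalRealSubfield K).subtype).codRestrict (maximalRealSubfield L)
        (fun y => algebraMap_mem_maximalRealSubfield K L y)
    letI : Algebra (maximalRealSubfield K) (maximalRealSubfield L) := f.toAlgebra
    haveI : IsScalarTower (maximalRealSubfield K) (maximalRealSubfield L) L :=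
      IsScalarTower.of_algebraMap_eq fun y => rfl
    refine ⟨𝔞.map (algebraMap (𝓞 (maximalRealSubfield K)) (𝓞 (maximalRealSubfield L))),
      algebraMap (𝓞 K) (𝓞 L) α,
      (map_ne_zero_iff _ (FaithfulSMul.algebraMap_injective (𝓞 K) (𝓞 L))).mpr hα0, ?_, ?_⟩
    · rw [Ideal.map_map,
        ← IsScalarTower.algebraMap_eq (𝓞 (maximalRealSubfield K)) (𝓞 (maximalRealSubfield L)) (𝓞 L),
        IsScalarTower.algebraMap_eq (𝓞 (maximalRealSubfield K)) (𝓞 K) (𝓞 L), ← Ideal.map_map, hα,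
        Ideal.map_span, Set.image_singleton]
    · apply RingOfIntegers.ext
      have hc := congrArg (fun x : 𝓞 K => ((algebraMap (𝓞 K) (𝓞 L) x : 𝓞 L) : L)) hconj
      simp only [Lemmermeyer1995.coe_algebraMap_ringOfIntegers, coe_ringOfIntegersComplexConj,
        ← Lemmermeyer1995.complexConj_algebraMap K L, map_mul] at hc
      rw [coe_ringOfIntegersComplexConj, Lemmermeyer1995.coe_algebraMap_ringOfIntegers, hc]
      simp [ι, Lemmermeyer1995.coe_algebraMap_ringOfIntegers]
  rw [← Subgroup.card_map_of_injective hι]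
  exact Subgroup.card_dvd_of_le hmap

/-- **Okazaki's Lemma 16, both general divisibilities, as printed: «Let `k ⊂ K` be two CM-fields.  Then
`κ_k Q_k w_k ∣ κ_K Q_K w_K` and `Q_k w_k ∣ Q_K w_K`»** (here `(K, L)` for `(k, K)`; the second is §5).
[cite: Okazaki2000, §3 Lemma 16] -/
theorem IsCMField.okazaki_lemma16_dvd :
    Nat.card (classGroupExtend (maximalRealSubfield K) K).ker * (indexRealUnits K * torsionOrder K) ∣
        Nat.card (classGroupExtend (maximalRealSubfield L) L).ker * (indexRealUnits L * torsionOrder L) ∧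
      indexRealUnits K * torsionOrder K ∣ indexRealUnits L * torsionOrder L :=
  ⟨IsCMField.card_ker_classGroupExtend_mul_indexRealUnits_mul_torsionOrder_dvd K L,
    IsCMField.indexRealUnits_mul_torsionOrder_dvd K L⟩

end FirstDivisibility

/-! ### §7. Lemma 14: `κ_F Q_F = 2 ⟹ F` non-primary, `Q_F = 2 ⟹ F` of unit radical form, and conversely unless `F = F⁺(√−1)`

> Okazaki, §3, **Definition 13.** "A CM-field `F` is said to be of *unit radical form* if `F = F⁺(√−η)` for some
> `η ∈ E⁺_{F⁺}`.  A CM-field `F` is said to be *non-primary* if `F = F⁺(√−δ)` for some `δ ∈ F⁺` which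
> generates a square ideal of `F⁺`; it is said to be *primary* otherwise."  **Lemma 14.** "Let `F` be a CM-field.
> Then `κ_F Q_F ∣ 2`.  When `κ_F Q_F = 2`, the CM-field `F` is non-primary.  When `Q_F = 2`, the CM-field `F` is
> of unit radical form.  Conversely, a non-primary CM-field `F` satisfies `κ_F Q_F = 2` unless `F = F⁺(√−1)`.  A
> CM-field `F` of unit radical form satisfies `Q_F = 2` unless `F = F⁺(√−1)`. […] *Proof.* This is well known
> (cf. [16] or [27, Theorems 4.12 and 10.3])."

With Washington's subgroup `U_F ≤ W_F` of §6 (`2 #U_F = κ_F Q_F w_F`, `φ(E_F) ≤ U_F`): `κ_F Q_F = 2 ⟺ U_F = W_F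
⟺ −1 ∈ U_F`, and `−1 = ᾱ/α` with `(α) = 𝔞𝓞_F` says exactly `α = √−δ`, `δ = αᾱ ∈ F⁺`, `(δ) = 𝔞²`;
`Q_F = 2 ⟺ φ(E_F) = W_F ⟺ −1 = ε/ε̄`, i.e. `ε = √−η`, `η = εε̄ ∈ E_{F⁺}`.  «Unless `F = F⁺(√−1)`»: when
`κ_F Q_F = 1` (resp. `Q_F = 1`) the subgroup `U_F` (resp. `φ(E_F)`) is `W_F²`, so `−1 ∈ W_F²` forces `√−1 ∈ F`.
"`F = F⁺(√−δ)`" is rendered by an element `α ∈ 𝓞_F`, `α ≠ 0`, `ᾱ = −α`, `α² = −δ` — such an `α` generates `F`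
over `F⁺` (`IsCMField.adjoin_simple_eq_top_of_complexConj_ne`); `δ` is taken integral (multiply by a square). -/

section LemmaFourteen

variable (K : Type) [Field K] [NumberField K] [IsCMField K]

/-- **A non-real element of a CM field generates it over the maximal real subfield**: `ᾱ ≠ α ⟹ F⁺(α) = F`
(`[F : F⁺] = 2`). [cite: Okazaki2000, §3 Def. 13 («F = F⁺(√−δ)»)] -/
theorem IsCMField.adjoin_simple_eq_top_of_complexConj_ne {α : K} (hα : complexConj K α ≠ α) :
    IntermediateField.adjoin (maximalRealSubfield K) {α} = ⊤ := by
  set E := IntermediateField.adjoin (maximalRealSubfield K) {α} with hE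
  have hne : E ≠ ⊥ := by
    intro h
    have hmem : α ∈ E := IntermediateField.mem_adjoin_simple_self (maximalRealSubfield K) α
    rw [h, IntermediateField.mem_bot] at hmem
    obtain ⟨y, hy⟩ := hmem
    apply hα
    rw [← hy]
    exact complexConj_apply_eq_self K y
  have h2 : Module.finrank (maximalRealSubfield K) K = 2 :=
    Algebra.IsQuadraticExtension.finrank_eq_two (maximalRealSubfield K) K
  have hdvd : Module.finrank (maximalRealSubfield K) E ∣ 2 := by
    rw [← h2, ← Module.finrank_mul_finrank (maximalRealSubfield K) E K]
    exact Dvd.intro _ rfl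
  have hne1 : Module.finrank (maximalRealSubfield K) E ≠ 1 := by
    rw [Ne, IntermediateField.finrank_eq_one_iff]; exact hne
  have hE2 : Module.finrank (maximalRealSubfield K) E = 2 := by
    rcases (Nat.dvd_prime Nat.prime_two).mp hdvd with h | h
    · exact absurd h hne1
    · exact h
  apply IntermediateField.eq_of_le_of_finrank_eq le_top
  rw [hE2, IntermediateField.finrank_top', h2]

omit [NumberField K] [IsCMField K] in
/-- `−1` is a root of unity. [folklore] -/
private theorem neg_one_mem_torsion : (-1 : (𝓞 K)ˣ) ∈ torsion K := by
  rw [torsion, CommGroup.mem_torsion]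
  exact (isOfFinOrder_iff_pow_eq_one).mpr ⟨2, two_pos, by simp⟩

omit [NumberField K] [IsCMField K] in
/-- If `−1` is the square of a root of unity then `√−1 ∈ F`. [folklore] -/
private theorem exists_sq_eq_neg_one_of_isSquare
    (h : ∃ ξ : torsion K, (⟨-1, neg_one_mem_torsion K⟩ : torsion K) = ξ ^ 2) :
    ∃ x : K, x ^ 2 = -1 := by
  obtain ⟨ξ, hξ⟩ := h
  refine ⟨(((ξ : (𝓞 K)ˣ) : 𝓞 K) : K), ?_⟩
  have h1 := congrArg (fun t : torsion K => (((t : (𝓞 K)ˣ) : 𝓞 K) : K)) hξ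
  simp only [Subgroup.coe_pow, Units.val_pow_eq_pow_val, Units.val_neg, Units.val_one] at h1
  push_cast at h1
  exact h1.symm

omit [IsCMField K] in
/-- The squares of the roots of unity form the subgroup of index `2` of the cyclic group `W_F` (its order
`w_F` is even). [folklore] -/
private theorem index_range_powMonoidHom_two :
    (powMonoidHom 2 : torsion K →* torsion K).range.index = 2 := by
  rw [IsCyclic.index_powMonoidHom_range, Nat.gcd_eq_right]
  exact even_iff_two_dvd.mp (even_torsionOrder K)

/-- **Norms from a CM field are totally positive**: if `y ∈ F⁺` becomes `x x̄` in `F` with `x ≠ 0`, then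
`σ(y) > 0` for every real embedding `σ` of `F⁺` (Okazaki: «all norms of numbers of `F` are totally positive»).
[cite: Okazaki2000, §5 Lemma 26 (proof)] -/
theorem IsCMField.embedding_pos_of_algebraMap_eq_mul_conj {y : maximalRealSubfield K} {x : K} (hx : x ≠ 0)
    (hy : algebraMap (maximalRealSubfield K) K y = x * complexConj K x) (σ : maximalRealSubfield K →+* ℝ) :
    0 < σ y := by
  -- extend `σ` to a complex embedding `τ` of `K`
  set τ : K →+* ℂ := NumberField.ComplexEmbedding.lift K (Complex.ofRealHom.comp σ) with hτdef
  have hτ : τ (algebraMap (maximalRealSubfield K) K y) = ((σ y : ℝ) : ℂ) := by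
    rw [hτdef, NumberField.ComplexEmbedding.lift_algebraMap_apply]; rfl
  rw [hy, map_mul, complexEmbedding_complexConj K τ x, Complex.mul_conj] at hτ
  have hx' : τ x ≠ 0 := (map_ne_zero _).mpr hx
  have hpos : 0 < Complex.normSq (τ x) := Complex.normSq_pos.mpr hx'
  have hre := congrArg Complex.re hτ
  simp only [Complex.ofReal_re] at hre
  rw [← hre]
  exact hpos

/-- **Lemma 14: `κ_F Q_F = 2 ⟹ F` is non-primary.**  If `κ_F Q_F = 2` then `U_F = W_F ∋ −1`, i.e. there is
`α ∈ 𝓞_F`, `α ≠ 0`, with `𝔞𝓞_F = (α)` and `ᾱ = −α`; then `δ = αᾱ = −α² ∈ 𝓞_{F⁺}` has `(δ) = 𝔞²` and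
`F = F⁺(α) = F⁺(√−δ)`. [cite: Okazaki2000, §3 Lemma 14] [cite: Washington1997, Thm. 10.3 (proof)] -/
theorem IsCMField.exists_sq_eq_neg_of_card_ker_mul_indexRealUnits_eq_two
    (h : Nat.card (classGroupExtend (maximalRealSubfield K) K).ker * indexRealUnits K = 2) :
    ∃ (α : 𝓞 K) (δ : 𝓞 (maximalRealSubfield K)) (𝔞 : Ideal (𝓞 (maximalRealSubfield K))),
      α ≠ 0 ∧ ringOfIntegersComplexConj K α = -α ∧
        algebraMap (𝓞 (maximalRealSubfield K)) (𝓞 K) δ = -(α ^ 2) ∧ Ideal.span {δ} = 𝔞 ^ 2 := by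
  obtain ⟨U, hU, -, h2⟩ := IsCMField.exists_subgroup_torsion_two_mul_card_eq K
  -- `#U = w`, so `U = W ∋ -1`
  have hcard : Nat.card U = Nat.card (torsion K) := by
    have h' : 2 * Nat.card U = 2 * torsionOrder K := by rw [h2, ← mul_assoc, h]
    have h'' := Nat.eq_of_mul_eq_mul_left two_pos h'
    rw [h'', torsionOrder]
  have hUtop : U = ⊤ := Subgroup.eq_top_of_card_eq U hcard
  have hmem : (⟨-1, neg_one_mem_torsion K⟩ : torsion K) ∈ U := by rw [hUtop]; exact Subgroup.mem_top _
  obtain ⟨𝔞, α, hα0, hα, hconj⟩ := (hU _).mp hmem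
  have hconj' : ringOfIntegersComplexConj K α = -α := by
    rw [hconj]; simp
  -- `δ = α ᾱ ∈ 𝓞 F⁺`
  have hfix : ringOfIntegersComplexConj K (α * ringOfIntegersComplexConj K α) =
      α * ringOfIntegersComplexConj K α := by
    rw [map_mul, conj_conj' K, mul_comm]
  obtain ⟨δ, hδ⟩ := (ringOfIntegersComplexConj_eq_self_iff K _).mp hfix
  refine ⟨α, δ, 𝔞, hα0, hconj', ?_, ?_⟩
  · rw [hδ, hconj']; ring
  · apply ideal_map_injective' K
    rw [Ideal.map_span, Set.image_singleton, hδ, Ideal.map_pow, hα, ← Ideal.span_singleton_mul_span_singleton,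
      hconj', Ideal.span_singleton_neg, pow_two]

/-- **Lemma 14, converse: a non-primary CM field `F = F⁺(√−δ)`, `(δ) = 𝔞²`, has `κ_F Q_F = 2` unless
`F = F⁺(√−1)`** (here: unless `−1` is a square in `F`).  For `α = √−δ`: `(α)² = (δ)𝓞_F = (𝔞𝓞_F)²`, so
`(α) = 𝔞𝓞_F` and `ᾱ/α = −1 ∈ U_F`; if `κ_F Q_F = 1` then `U_F = W_F²` (index `2` in the cyclic `W_F`), so `−1`
is the square of a root of unity. [cite: Okazaki2000, §3 Lemma 14] [cite: Washington1997, Thm. 10.3 (proof)] -/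
theorem IsCMField.card_ker_mul_indexRealUnits_eq_two_of_sq_eq_neg {α : 𝓞 K}
    {δ : 𝓞 (maximalRealSubfield K)} {𝔞 : Ideal (𝓞 (maximalRealSubfield K))} (hα0 : α ≠ 0)
    (hconj : ringOfIntegersComplexConj K α = -α)
    (hδ : algebraMap (𝓞 (maximalRealSubfield K)) (𝓞 K) δ = -(α ^ 2)) (h𝔞 : Ideal.span {δ} = 𝔞 ^ 2)
    (hi : ∀ x : K, x ^ 2 ≠ -1) :
    Nat.card (classGroupExtend (maximalRealSubfield K) K).ker * indexRealUnits K = 2 := by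
  obtain ⟨U, hU, hle, h2⟩ := IsCMField.exists_subgroup_torsion_two_mul_card_eq K
  -- `(α) = 𝔞𝓞_F`
  have hmap : 𝔞.map (algebraMap (𝓞 (maximalRealSubfield K)) (𝓞 K)) = Ideal.span {α} := by
    apply ideal_eq_of_sq_eq
    rw [← Ideal.map_pow, ← h𝔞, Ideal.map_span, Set.image_singleton, hδ, Ideal.span_singleton_neg,
      Ideal.span_singleton_pow]
  -- `-1 ∈ U`
  have hmem : (⟨-1, neg_one_mem_torsion K⟩ : torsion K) ∈ U :=
    (hU _).mpr ⟨𝔞, α, hα0, hmap, by rw [hconj]; simp⟩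
  -- `κ Q ∣ 2`; if `κ Q = 1` then `U = W²`
  have hdvd : Nat.card (classGroupExtend (maximalRealSubfield K) K).ker * indexRealUnits K ∣ 2 := by
    have h := Nat.mul_dvd_mul (IsCMField.card_ker_classGroupExtend_dvd_index_range K) (dvd_refl (indexRealUnits K))
    rwa [mul_comm (unitsMulComplexConjInv K).range.index, indexRealUnits_mul_eq] at h
  rcases (Nat.dvd_prime Nat.prime_two).mp hdvd with h1 | h2'
  · exfalso
    -- `#U = w/2` and `W² ≤ φ(E) ≤ U`, so `U = W²`
    have hsq_le : (powMonoidHom 2 : torsion K →* torsion K).range ≤ U := by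
      rw [← map_unitsMulComplexConjInv_torsion]
      exact (Subgroup.map_le_range _ _).trans hle
    have hcardU : 2 * Nat.card U = Nat.card (torsion K) := by
      rw [h2, ← mul_assoc, h1, one_mul, torsionOrder]
    have hcardsq := (powMonoidHom 2 : torsion K →* torsion K).range.card_mul_index
    rw [index_range_powMonoidHom_two K] at hcardsq
    have heq : (powMonoidHom 2 : torsion K →* torsion K).range = U :=
      Subgroup.eq_of_le_of_card_ge hsq_le (by omega)
    rw [← heq] at hmem
    obtain ⟨ξ, hξ⟩ := hmem
    obtain ⟨x, hx⟩ := exists_sq_eq_neg_one_of_isSquare K ⟨ξ, by rw [← hξ]; rfl⟩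
    exact hi x hx
  · exact h2'

/-- `\overline{-u} = -ū` on units. [folklore] -/
private theorem unitsComplexConj_neg (u : (𝓞 K)ˣ) : unitsComplexConj K (-u) = -unitsComplexConj K u :=
  Units.ext (by rw [coe_unitsComplexConj', Units.val_neg, Units.val_neg, map_neg, coe_unitsComplexConj'])

/-- **Lemma 14: `Q_F = 2 ⟹ F` is of unit radical form**: then `φ(E_F) = W_F ∋ −1`, i.e. `ε̄ = −ε` for a unit
`ε`, and `η = εε̄ = −ε²` is a unit of `F⁺` with `F = F⁺(ε) = F⁺(√−η)`; `η` is totally positive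
(`IsCMField.embedding_pos_of_algebraMap_eq_mul_conj`). [cite: Okazaki2000, §3 Def. 13 and Lemma 14]
[cite: Washington1997, Thm. 4.12 (proof)] -/
theorem IsCMField.exists_unit_sq_eq_neg_of_indexRealUnits_eq_two (hQ : indexRealUnits K = 2) :
    ∃ (ε : (𝓞 K)ˣ) (η : (𝓞 (maximalRealSubfield K))ˣ), ringOfIntegersComplexConj K ε = -ε ∧
      algebraMap (𝓞 (maximalRealSubfield K)) (𝓞 K) η = -((ε : 𝓞 K) ^ 2) ∧
      algebraMap (𝓞 (maximalRealSubfield K)) (𝓞 K) η = ε * ringOfIntegersComplexConj K ε := by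
  -- `range φ = ⊤ ∋ -1`
  have hidx : (unitsMulComplexConjInv K).range.index = 1 := by
    have h := indexRealUnits_mul_eq K
    rw [hQ] at h
    omega
  have htop : (unitsMulComplexConjInv K).range = ⊤ := Subgroup.index_eq_one.mp hidx
  obtain ⟨ε, hε⟩ : (⟨-1, neg_one_mem_torsion K⟩ : torsion K) ∈ (unitsMulComplexConjInv K).range := by
    rw [htop]; exact Subgroup.mem_top _
  -- `ε̄ = -ε`
  have hεu : unitsComplexConj K ε = -ε := by
    have h := congrArg (fun t : torsion K => (t : (𝓞 K)ˣ)) hε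
    simp only [unitsMulComplexConjInv_apply] at h
    -- `h : ε * (conj ε)⁻¹ = -1`
    have h' : ε = -unitsComplexConj K ε := by rw [← neg_one_mul, ← h, inv_mul_cancel_right]
    exact neg_eq_iff_eq_neg.mp h'.symm
  have hεc : ringOfIntegersComplexConj K ε = -ε := by
    rw [← coe_unitsComplexConj' K, hεu, Units.val_neg]
  -- `η = ε ε̄` is a real unit
  have hreal : unitsComplexConj K (ε * unitsComplexConj K ε) = ε * unitsComplexConj K ε := by
    rw [map_mul, hεu, unitsComplexConj_neg, hεu, neg_neg, neg_mul, mul_neg]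
  obtain ⟨η, hη⟩ := (mem_realUnits_iff K _).mp ((unitsComplexConj_eq_self_iff K _).mp hreal)
  -- `hη : algebraMap η = ↑(ε * conj ε)`
  refine ⟨ε, η, hεc, ?_, ?_⟩
  · rw [hη, Units.val_mul, coe_unitsComplexConj', hεc]; ring
  · rw [hη, Units.val_mul, coe_unitsComplexConj']

/-- **Lemma 14, converse: a CM field of unit radical form, `F = F⁺(√−η)` with `η` a unit — i.e. with a unit `ε`
of `F` such that `ε̄ = −ε` — has `Q_F = 2` unless `F = F⁺(√−1)`**: `φ(ε) = ε/ε̄ = −1`, and if `Q_F = 1` then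
`φ(E_F) = W_F²`, so `−1` is the square of a root of unity. [cite: Okazaki2000, §3 Lemma 14]
[cite: Washington1997, Thm. 4.12 (proof)] -/
theorem IsCMField.indexRealUnits_eq_two_of_unit_conj_eq_neg {ε : (𝓞 K)ˣ}
    (hε : ringOfIntegersComplexConj K ε = -ε) (hi : ∀ x : K, x ^ 2 ≠ -1) : indexRealUnits K = 2 := by
  have hεu : unitsComplexConj K ε = -ε := Units.ext (by rw [coe_unitsComplexConj', hε, Units.val_neg])
  have hφ : unitsMulComplexConjInv K ε = ⟨-1, neg_one_mem_torsion K⟩ := by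
    apply Subtype.ext
    rw [unitsMulComplexConjInv_apply, hεu, inv_neg, mul_neg, mul_inv_cancel]
  rcases indexRealUnits_eq_one_or_two K with h1 | h2
  · exfalso
    obtain ⟨r, hr⟩ := (Lemmermeyer1995.indexRealUnits_eq_one_iff K).mp h1 ε
    rw [hφ] at hr
    obtain ⟨x, hx⟩ := exists_sq_eq_neg_one_of_isSquare K ⟨r, by rw [hr, pow_two]⟩
    exact hi x hx
  · exact h2

/-- **Lemma 14, the two equivalences for a CM field not containing `√−1`:**
`κ_F Q_F = 2 ⟺ F` is non-primary, and `Q_F = 2 ⟺ F` is of unit radical form (forms as in the two theorems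
above). [cite: Okazaki2000, §3 Lemma 14] -/
theorem IsCMField.lemma14_iff (hi : ∀ x : K, x ^ 2 ≠ -1) :
    (Nat.card (classGroupExtend (maximalRealSubfield K) K).ker * indexRealUnits K = 2 ↔
      ∃ (α : 𝓞 K) (δ : 𝓞 (maximalRealSubfield K)) (𝔞 : Ideal (𝓞 (maximalRealSubfield K))),
        α ≠ 0 ∧ ringOfIntegersComplexConj K α = -α ∧
          algebraMap (𝓞 (maximalRealSubfield K)) (𝓞 K) δ = -(α ^ 2) ∧ Ideal.span {δ} = 𝔞 ^ 2) ∧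
    (indexRealUnits K = 2 ↔ ∃ ε : (𝓞 K)ˣ, ringOfIntegersComplexConj K ε = -ε) := by
  refine ⟨⟨IsCMField.exists_sq_eq_neg_of_card_ker_mul_indexRealUnits_eq_two K, ?_⟩, ⟨fun h => ?_, ?_⟩⟩
  · rintro ⟨α, δ, 𝔞, hα0, hconj, hδ, h𝔞⟩
    exact IsCMField.card_ker_mul_indexRealUnits_eq_two_of_sq_eq_neg K hα0 hconj hδ h𝔞 hi
  · obtain ⟨ε, -, hε, -, -⟩ := IsCMField.exists_unit_sq_eq_neg_of_indexRealUnits_eq_two K h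
    exact ⟨ε, hε⟩
  · rintro ⟨ε, hε⟩
    exact IsCMField.indexRealUnits_eq_two_of_unit_conj_eq_neg K hε hi

end LemmaFourteen

end Literature.NumberTheory.NumberFields

end
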